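import Summits.AtomisticToContinuum.FouriersLaw.Theses.HonestZwanzig
import Summits.AtomisticToContinuum.FouriersLaw.Theorems.HonestZwanzigNetworkReductionPackage
import Summits.AtomisticToContinuum.FouriersLaw.Theorems.HonestZwanzigFeshbachIdentitiesLaplacePositivity
import Summits.AtomisticToContinuum.FouriersLaw.Theorems.HonestZwanzigGeneratorSiteEnergy
import Summits.AtomisticToContinuum.FouriersLaw.Theorems.HonestZwanzigParityStatics
import Summits.AtomisticToContinuum.FouriersLaw.Theorems.HonestZwanzigRobinCoercivityStubFeshbachIdentities
import Summits.AtomisticToContinuum.FouriersLaw.Theorems.HonestZwanzigRobinCoercivityContactBlock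
import Summits.AtomisticToContinuum.FouriersLaw.Theorems.HonestZwanzigNetworkReductionRobin

/-!
# Disproof of `RobinCoercivity` (crux stmt-AtomisticToContinuum-12695, route `HonestZwanzig`) — findings

Standing crux-disprover work file (cdisprove, cycle 1, 2026-08-16). The crux: for `pinnedChain ω₂ lam β γ` (all `> 0`),
`T > 0`: `∃ c > 0, ∀ N ≥ 2, ∃ s₀ > 0, ∀ s ∈ (0,s₀), ∀ ξ, c·(Σ_b (ξ_{b+1}−ξ_b)² + ξ_0² + ξ_{N−1}²) ≤ ξᵀ𝔽_N(s)ξ`,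
`𝔽_N(s)_{xy} = s·Cov(e_x,e_y) − Cov(e_x, L e_y) − schur_s(L†e_x, L e_y)` (elaborates: probe rc 0; no junk operators bite —
`(G s)⁻¹` is `Matrix.inv` but `G(s)` is positive definite for `s > 0` by `FeshbachIdentities` (iv); `lap_s` is a Bochner
integral whose integrability is clause (i); `s₀` may depend on `N`, so the claim is about `𝔽_N(0⁺)` at each `N`,
uniformly in `N`; quantifier order matches the informal text).

**VERDICT (cycle 1): NO KILL.** The statement is an N-uniform lower bound on the Feshbach–Schur complement of the thermostatted
Liouvillian of the ANHARMONIC chain — open-problem level; no finite computation or junk model reaches it. What was found: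

1. NUMERICS (kit job `j016689`, exact Gaussian/Lyapunov algebra, evidence attached to the item): at the HARMONIC point
   `lam = β = 0` (excluded by the hypotheses, but the natural place to look for a failure by continuity) Robin coercivity
   HOLDS, uniformly in `N`:  `c_N(0⁺) := min pencil(𝔽_sym(0), Robin)` for `(ω₂, γ, T) = (1,1,1)`:
   `N = 2: 0.3556, 3: 0.1431, 4: 0.1458, 6: 0.1432, 8: 0.1441, 12: 0.1435, 16: 0.1438, 24: 0.1436, 32: 0.1436,
   48: 0.1436, 64: 0.1436, 96: 0.1436`;  `γ = 0.2: 0.0664`, `γ = 5: 0.0472`, `γ = 25: 0.0097`, `ω₂ = 4: 0.0975`,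
   `ω₂ = 1/4: 0.1686` (all flat in `N`); `𝔽 ∝ T²` exactly; `λ_min(𝔽_sym) ≈ 2.0/N²` (`𝔽 ≈ K·Δ_N + Γ_eff`); identity checks
   `|𝔽 − χG⁻¹χ| ~ 1e-14`, `Cov(e_x, L e_y) = −γT²[x=y∈∂]` exact, `G` symmetric. So the crux does NOT encode diffusion:
   ballistic transport satisfies it (energy fluctuations relax FASTER than a Robin heat flow); the failure of Fourier's law
   at the integrable point is carried entirely by `OrthogonalOhm` (`ρ_b ~ N`). ANHARMONICITY IS PROBABLY NOT LOAD-BEARING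
   here, and there is no refutation by continuity from the harmonic member.
2. LOAD-BEARING HYPOTHESES (theorems below): `γ > 0` IS load-bearing — `robinCoercivity_false_without_coupling`
   (UNCONDITIONAL: at `γ = 0`, `N = 2`, `L e_0 = −j_0 = −L e_1`, so `1ᵀ𝔽_2(s)1 = s·1ᵀCov(e,e)1 → 0` by pure sign
   bookkeeping while `Robin(1) = 2`). `T > 0`: only through junk (`gibbsMeasure N T = 0` for `T ≤ 0`, not integrable
   tilt — then `𝔽 ≡ 0`; not formalised, uninteresting). `lam, β > 0`: numerically NOT load-bearing (item 1). `ω₂ > 0`: needed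
   for the Gibbs measure / confinement of `q` (with `ω₂ = lam = 0` the tilt is not integrable: junk again).
3. TIGHTNESS (stated with the route's support item `FeshbachIdentities` as a hypothesis, as in the lead's `Lines/LinAlg.lean`;
   the lead has meanwhile LANDED `Robin.stub_feshbachIdentities`, so the primed versions `robinConst_le_contact'`,
   `not_…'` below are UNCONDITIONAL):
   `one_feshbach_one_le`: `1ᵀ𝔽_N(s)1 ≤ s·1ᵀCov(e,e)1 + 2γT²` for ALL `N ≥ 2`, `s > 0` (the memory term against the total
   energy is `schur_s(w,w) ≥ 0`, `w = γ(T−p_0²)+γ(T−p_{N−1}²)`: `schur_self_nonneg`, the orthogonal-dynamics resolvent is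
   positive on the diagonal); hence EVERY admissible constant obeys `c ≤ γT²` (`robinConst_le_contact`) — the Robin constant
   never beats the bare contact conductance; the LinAlg flux-bound constant must satisfy `K ≥ 1/(γT²)`. Numerically the true
   ceiling `1ᵀ𝔽_N(0⁺)1/2 = γT² − γ²schur_0(W,W)/2` is `0.904` (γ=1), `0.199` (γ=0.2), `1.374` (γ=5), `0.374` (γ=25): the
   renormalised contact conductance is non-monotone in `γ` (Kapitza) and `≪ γT²` at strong coupling.
4. REFUTED NATURAL STRENGTHENINGS (unconditional, primed versions): no `T`-uniform constant (`not_robinCoercivityUniformInT`), no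
   constant uniform as `γ ↓ 0` (`not_robinCoercivityUniformInCoupling`), no uniform `ℓ²`-ellipticity `𝔽_N(s) ≥ c·Id`
   (`not_uniformL2Ellipticity`, `c ≤ 2γT²/N`): the crux's Robin normalisation is exactly right — the constant profile
   (total energy) only sees the contacts. NOT refuted (probably true, numerically monotone): `s₀` uniform in `N`; all `s > 0`.
5. LINE LinAlg (lead prover-line-…-12695-0): stubs 2–4 (`stub_feshbachMatrix`, `stub_gramDuality`, `stub_robinIncidence`)
   re-derived by hand here and meanwhile LANDED by the lead (`HonestZwanzigRobinCoercivityStub*.lean`); stub 1 is the route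
   item `FeshbachIdentities` (10 support files landed); stub 5 `stub_fluxBound` is EQUIVALENT to the crux (polar duality both
   ways) — the line has no attack surface other than the crux itself. `RobinCoercivity_of` smuggles no gap.
6. DECOMPOSITION (`feshbach_quadratic_decomposition`, mod `FeshbachIdentities`; numerically verified to 1e-15, job
   `j017376`): `ξᵀ𝔽(s)ξ = sξᵀχξ + γT²(ξ_0²+ξ_{N−1}²) − schur_s(w_ξ,w_ξ) − 2 schur_s(w_ξ,j_ξ) + schur_s(j_ξ,j_ξ)` with
   `w_ξ = γΣ_c ξ_c(T − p_c²)` (contacts, even), `j_ξ = Σ_b(ξ_{b+1}−ξ_b)j_b` (odd); `schur_s(j_ξ,w_ξ) = −schur_s(w_ξ,j_ξ)`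
   (`schur_odd_even`). AT THE HARMONIC POINT: the Robin constant IS the bulk-ellipticity floor of the bond memory matrix
   `𝔎_N(0)_{bb'} = schur_0(j_b,j_b')`: `λ_min(𝔎_sym) = 0.1456, 0.1446, 0.1441, 0.1440` (`N = 8,16,32,64`) vs `c_N = 0.1436`,
   attained on ROUGH sign-alternating bond profiles, while `𝔎(0)` itself is DENSE and `O(N)` (ballistic; row sums
   `ρ_b = schur_0(j_b,J) = 6.7, 33, 148, 624 ∝ N²` — harmonic `OrthogonalOhm` fails like `N²`); contact block
   `γT² − γ²S_sym ≈ 0.905` (γ=1) with margin to spare; cross memory `|schur_0(w_c, j_b)| ≤ 0.09` with a constant non-local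
   tail `≈ −0.03` in `b` (harmless after telescoping). WARNING for the planner's two-layer plan (BulkEllipticity +
   ContactMargin ⇒ RobinCoercivity): the even–odd cross memory `b = schur_s(w_ξ, j_ξ)` is NOT controlled by any positivity
   (joint Schur Gram matrix `[[a,b],[−b,d]]`), it must be bounded separately.
7. WHY IT RESISTS / what a kill would need: by the exact decomposition (even/odd split + time reversal)
   `ξᵀ𝔽(s)ξ = sξᵀχξ + γT²(ξ_0²+ξ_{N−1}²) − γ²schur_s(w_ξ,w_ξ) + schur_s(j_{∇ξ}, j_{∇ξ}) − 2γ schur_s(w_ξ, j_{∇ξ})`,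
   `w_ξ = ξ_0 w_0 + ξ_{N−1}w_{N−1}`, `j_{∇ξ} = Σ_b(ξ_{b+1}−ξ_b) j_b`, a refutation needs either a degenerating renormalised
   contact conductance or an `N`-growing failure of coercivity of the bond-current memory matrix `𝔎_N(0)_{bb'} =
   schur_0(j_b, j_b')` on rough profiles — i.e. SUPER-diffusive time-integrated energy autocorrelations of the anharmonic
   pinned chain. Nothing in print or in the tree gives a handle; the harmonic computation goes the other way. Free bounds
   that do NOT help: `ξᵀ𝔽(s)ξ ≥ sξᵀχξ` (degenerates) and the Schur complement of the SYMMETRIC part `s − L_sym` onto the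
   energy profiles, which vanishes as `s ↓ 0` (a corrector `η ∈ Ran Q` absorbs `∂_p e_x`): coercivity must come from
   hypocoercive structure, not from the dissipative part alone.

Landing: the theorems below are filed as `Theorems/RobinCoercivity/Negative/{SchurPositivity,WithoutCoupling,ContactCeiling,Decomposition}.lean`
(`--supports stmt-AtomisticToContinuum-12695`), ALL ACCEPTED: p102378 `WithoutCoupling` · p103180 `SchurPositivity` (commit
7c31a3b0725b) · p105753 `Decomposition` (7621d4dbdbca) · p105854 `ContactCeiling` (c03ddcce3628); axioms `propext,
Classical.choice, Quot.sound` throughout, no `sorry`. This work file carries the same proofs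
self-contained under the `…Cruxes.RobinCoercivity.Disproof` namespace (so that it elaborates independently of the farm's build
of the new modules); the landed `…Theorems.RobinCoercivity.Negative.*` declarations are the ones to import.
-/

noncomputable section

open MeasureTheory Finset Matrix
open Literature.MathematicalPhysics.KineticTheory.HeatConduction
open Summit.AtomisticToContinuum.FouriersLaw.Theses.HonestZwanzig
open Summit.AtomisticToContinuum.FouriersLaw.Theorems.HonestZwanzig
open Summit.AtomisticToContinuum.FouriersLaw.Theorems.HonestZwanzig.NetworkReduction

namespace Summit.AtomisticToContinuum.FouriersLaw.Cruxes.RobinCoercivity.Disproof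


/-! ### Fixed `N`, fixed `s`: abstract gadgets with their defining equations (as in `…NetworkReductionPackage`) -/

section FixedN

variable {ω₂ lam β γ : ℝ} {N : ℕ} {T : ℝ}
  {Adm : (PhaseSpace N → ℝ) → Prop}
  {corr : (PhaseSpace N → ℝ) → (PhaseSpace N → ℝ) → ℝ → ℝ}
  {lap : ℝ → (PhaseSpace N → ℝ) → (PhaseSpace N → ℝ) → ℝ}
  {cov : (PhaseSpace N → ℝ) → (PhaseSpace N → ℝ) → ℝ}
  {e : Fin N → PhaseSpace N → ℝ}
  (hAdm : ∀ f, Adm f ↔ (Continuous f ∧ ∃ A : ℝ, ∀ z,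
    |f z| ≤ A * Real.exp ((pinnedChain ω₂ lam β γ).hamiltonian N z / (8 * T))))
  (hcorr : ∀ f g t, corr f g t =
    (∫ z, f z * (∫ y, g y ∂((pinnedChain ω₂ lam β γ).transitionKernel N T T t.toNNReal z))
      ∂(pinnedChain ω₂ lam β γ).gibbsMeasure N T) -
    (∫ z, f z ∂(pinnedChain ω₂ lam β γ).gibbsMeasure N T) *
      (∫ z, g z ∂(pinnedChain ω₂ lam β γ).gibbsMeasure N T))
  (hlap : ∀ s f g, lap s f g = ∫ t in Set.Ioi (0 : ℝ), Real.exp (-(s * t)) * corr f g t)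
  (hcov : ∀ f g, cov f g = (∫ z, f z * g z ∂(pinnedChain ω₂ lam β γ).gibbsMeasure N T) -
    (∫ z, f z ∂(pinnedChain ω₂ lam β γ).gibbsMeasure N T) *
      (∫ z, g z ∂(pinnedChain ω₂ lam β γ).gibbsMeasure N T))
  (he : ∀ x z, e x z = z.2 x ^ 2 / 2 + (pinnedChain ω₂ lam β γ).U (z.1 x) +
    ∑ j : Fin N, ((if j.val = x.val + 1 then (pinnedChain ω₂ lam β γ).V (z.1 j - z.1 x) / 2 else 0) +
      (if x.val = j.val + 1 then (pinnedChain ω₂ lam β γ).V (z.1 x - z.1 j) / 2 else 0)))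
  (hFI : ∀ f g : PhaseSpace N → ℝ, Adm f → Adm g →
    Integrable f ((pinnedChain ω₂ lam β γ).gibbsMeasure N T) ∧
    (∀ t : ℝ, 0 ≤ t → Integrable (fun z => f z *
      (∫ y, g y ∂((pinnedChain ω₂ lam β γ).transitionKernel N T T t.toNNReal z)))
      ((pinnedChain ω₂ lam β γ).gibbsMeasure N T)) ∧
    IntegrableOn (corr f g) (Set.Ioi 0) ∧
    (∀ t : ℝ, 0 ≤ t → corr f g t = corr (fun z => g (z.1, -z.2)) (fun z => f (z.1, -z.2)) t) ∧
    (∀ s : ℝ, 0 < s → ∀ x : Fin N,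
      s * lap s (e x) g - cov (e x) g =
        lap s (fun z => (pinnedChain ω₂ lam β γ).generator N T T (e x) (z.1, -z.2)) g ∧
      s * lap s f (e x) - cov f (e x) = lap s f ((pinnedChain ω₂ lam β γ).generator N T T (e x))))
  (hGSE : ∀ (x : Fin N) (z : PhaseSpace N), (pinnedChain ω₂ lam β γ).generator N T T (e x) z =
    (∑ b : Fin N, ((if x.val = b.val + 1 then (pinnedChain ω₂ lam β γ).bondCurrent N b z else 0) -
      (if b = x then (pinnedChain ω₂ lam β γ).bondCurrent N b z else 0))) +
    (if x.val = 0 then (pinnedChain ω₂ lam β γ).γ * (T - z.2 x ^ 2) else 0) +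
    (if x.val = N - 1 then (pinnedChain ω₂ lam β γ).γ * (T - z.2 x ^ 2) else 0))
  (hPS : ∀ x y : Fin N, cov (e x) ((pinnedChain ω₂ lam β γ).generator N T T (e y)) =
    -(if x = y ∧ (x.val = 0 ∨ x.val = N - 1) then (pinnedChain ω₂ lam β γ).γ * T ^ 2 else 0))
  (hω : 0 < ω₂) (hl : 0 ≤ lam) (hβ : 0 ≤ β) (hγ : 0 ≤ γ) (hT : 0 < T)

include hAdm hcorr hlap hFI hω hl hβ hT in
/-- Unweighted finite sums in the SECOND slot of `lap_s`, `s ≥ 0` (time reversal of `lap_sum_left'`). -/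
theorem lap_sum_right' {ι : Type*} (S : Finset ι) (gs : ι → PhaseSpace N → ℝ)
    (hgs : ∀ i ∈ S, Adm (gs i)) {f : PhaseSpace N → ℝ} (hf : Adm f) {s : ℝ} (hs : 0 ≤ s) :
    lap s f (fun z => ∑ i ∈ S, gs i z) = ∑ i ∈ S, lap s f (gs i) := by
  have hsum : Adm (fun z => ∑ i ∈ S, gs i z) :=
    adm_sum Adm hAdm S gs (adm_const Adm hAdm hω hl hβ hT 0) hgs
  rw [lap_rev hlap hFI hf hsum]
  have hfun : (fun z : PhaseSpace N => ∑ i ∈ S, gs i (z.1, -z.2)) =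
      fun z => ∑ i ∈ S, (fun w : PhaseSpace N => gs i (w.1, -w.2)) z := rfl
  rw [hfun, lap_sum_left' hAdm hcorr hlap hFI hω hl hβ hT S (fun i w => gs i (w.1, -w.2))
    (fun i hi => adm_rev Adm hAdm (hgs i hi)) (adm_rev Adm hAdm hf) hs]
  refine Finset.sum_congr rfl fun i hi => ?_
  rw [← lap_rev hlap hFI hf (hgs i hi)]

include hAdm hcorr hlap he hFI hω hl hβ hT in
/-- Linearity of the Schur pairing in the FIRST slot: `Σ_i schur_s(f_i, g) = schur_s(Σ_i f_i, g)` for admissible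
`f_i, g`, where `schur_s(f,g) = lap_s(f,g) − Σ_{u,v} lap_s(f,e_u) (G⁻¹)_{uv} lap_s(e_v,g)` for ANY matrix `G`. -/
theorem sum_schur_left {s : ℝ} (hs : 0 ≤ s) (G : Matrix (Fin N) (Fin N) ℝ)
    (schur : (PhaseSpace N → ℝ) → (PhaseSpace N → ℝ) → ℝ)
    (hschur : ∀ f g, schur f g = lap s f g - ∑ u, ∑ v, lap s f (e u) * G⁻¹ u v * lap s (e v) g)
    {ι : Type*} (S : Finset ι) (fs : ι → PhaseSpace N → ℝ) (hfs : ∀ i ∈ S, Adm (fs i))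
    {g : PhaseSpace N → ℝ} (hg : Adm g) :
    ∑ i ∈ S, schur (fs i) g = schur (fun z => ∑ i ∈ S, fs i z) g := by
  have hex : ∀ x, Adm (e x) := fun x => adm_e Adm hAdm e he hω hl hβ hT x
  rw [hschur, lap_sum_left' hAdm hcorr hlap hFI hω hl hβ hT S fs hfs hg hs]
  have h2 : ∀ u, lap s (fun z => ∑ i ∈ S, fs i z) (e u) = ∑ i ∈ S, lap s (fs i) (e u) :=
    fun u => lap_sum_left' hAdm hcorr hlap hFI hω hl hβ hT S fs hfs (hex u) hs
  simp only [h2, hschur, Finset.sum_sub_distrib, Finset.sum_mul]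
  congr 1
  rw [Finset.sum_comm]
  refine Finset.sum_congr rfl fun u _ => ?_
  rw [Finset.sum_comm]

include hAdm hcorr hlap he hFI hω hl hβ hT in
/-- Linearity of the Schur pairing in the SECOND slot: `Σ_k schur_s(f, g_k) = schur_s(f, Σ_k g_k)`. -/
theorem sum_schur_right {s : ℝ} (hs : 0 ≤ s) (G : Matrix (Fin N) (Fin N) ℝ)
    (schur : (PhaseSpace N → ℝ) → (PhaseSpace N → ℝ) → ℝ)
    (hschur : ∀ f g, schur f g = lap s f g - ∑ u, ∑ v, lap s f (e u) * G⁻¹ u v * lap s (e v) g)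
    {κ : Type*} (R : Finset κ) (gs : κ → PhaseSpace N → ℝ) (hgs : ∀ k ∈ R, Adm (gs k))
    {f : PhaseSpace N → ℝ} (hf : Adm f) :
    ∑ k ∈ R, schur f (gs k) = schur f (fun z => ∑ k ∈ R, gs k z) := by
  have hex : ∀ x, Adm (e x) := fun x => adm_e Adm hAdm e he hω hl hβ hT x
  rw [hschur, lap_sum_right' hAdm hcorr hlap hFI hω hl hβ hT R gs hgs hf hs]
  have h3 : ∀ v, lap s (e v) (fun z => ∑ k ∈ R, gs k z) = ∑ k ∈ R, lap s (e v) (gs k) :=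
    fun v => lap_sum_right' hAdm hcorr hlap hFI hω hl hβ hT R gs hgs (hex v) hs
  simp only [h3, hschur, Finset.sum_sub_distrib, Finset.mul_sum]
  congr 1
  rw [Finset.sum_comm]
  refine Finset.sum_congr rfl fun u _ => ?_
  rw [Finset.sum_comm]

include hAdm hcorr hlap he hFI hω hl hβ hT in
/-- **Bilinearity of the Schur pairing**: `Σ_x Σ_y schur_s(f_x, g_y) = schur_s(Σ_x f_x, Σ_y g_y)` for admissible
families (any matrix `G` in the definition of `schur_s`). -/
theorem sum_sum_schur_eq_schur_sum {s : ℝ} (hs : 0 ≤ s) (G : Matrix (Fin N) (Fin N) ℝ)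
    (schur : (PhaseSpace N → ℝ) → (PhaseSpace N → ℝ) → ℝ)
    (hschur : ∀ f g, schur f g = lap s f g - ∑ u, ∑ v, lap s f (e u) * G⁻¹ u v * lap s (e v) g)
    {ι κ : Type*} (S : Finset ι) (R : Finset κ) (fs : ι → PhaseSpace N → ℝ) (gs : κ → PhaseSpace N → ℝ)
    (hfs : ∀ i ∈ S, Adm (fs i)) (hgs : ∀ k ∈ R, Adm (gs k)) :
    ∑ i ∈ S, ∑ k ∈ R, schur (fs i) (gs k) = schur (fun z => ∑ i ∈ S, fs i z) (fun z => ∑ k ∈ R, gs k z) := by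
  have hgsum : Adm (fun z => ∑ k ∈ R, gs k z) :=
    adm_sum Adm hAdm R gs (adm_const Adm hAdm hω hl hβ hT 0) hgs
  have h1 : ∀ i ∈ S, ∑ k ∈ R, schur (fs i) (gs k) = schur (fs i) (fun z => ∑ k ∈ R, gs k z) :=
    fun i _ => sum_schur_right hAdm hcorr hlap he hFI hω hl hβ hT hs G schur hschur R gs hgs (hfs i ‹_›)
  rw [Finset.sum_congr rfl h1]
  exact sum_schur_left hAdm hcorr hlap he hFI hω hl hβ hT hs G schur hschur S fs hfs hgsum

/-- An admissible observable is nice with weight `ϑ = 1/(8T)` and a nonnegative constant. -/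
theorem adm_nice (hAdm : ∀ f, Adm f ↔ (Continuous f ∧ ∃ A : ℝ, ∀ z,
    |f z| ≤ A * Real.exp ((pinnedChain ω₂ lam β γ).hamiltonian N z / (8 * T))))
    {f : PhaseSpace N → ℝ} (hf : Adm f) :
    Continuous f ∧ ∃ C : ℝ, 0 ≤ C ∧ ∀ z,
      |f z| ≤ C * Real.exp ((1 / (8 * T)) * (pinnedChain ω₂ lam β γ).hamiltonian N z) := by
  rw [hAdm] at hf
  obtain ⟨hfc, A, hA⟩ := hf
  refine ⟨hfc, max A 0, le_max_right _ _, fun z => ?_⟩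
  have h1 := hA z
  have h2 : (pinnedChain ω₂ lam β γ).hamiltonian N z / (8 * T) =
      (1 / (8 * T)) * (pinnedChain ω₂ lam β γ).hamiltonian N z := by ring
  rw [← h2]
  exact h1.trans (mul_le_mul_of_nonneg_right (le_max_left _ _) (Real.exp_pos _).le)

include hAdm hcorr hlap he hFI hω hl hβ hT in
/-- **`schur_s(g, g) ≥ 0`** for admissible `g`, `s > 0`, `β, γ > 0`, `N ≥ 1`: with `b'_v = lap_s(e_v, g)`,
`a = −G(s)⁻¹ b'` and `U = g + Σ_u a_u e_u` one has `schur_s(g,g) = lap_s(U,U) = ⟨Ũ, R_s Ũ⟩_μ ≥ s ‖R_s Ũ‖² ≥ 0`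
(`G(s)` symmetric with positive quadratic form, hence invertible). -/
theorem schur_self_nonneg (hβ' : 0 < β) (hγ' : 0 < γ) (hN : 0 < N) {s : ℝ} (hs : 0 < s)
    (G : Matrix (Fin N) (Fin N) ℝ) (hG : ∀ x y, G x y = lap s (e x) (e y))
    (hGp : ∀ v : Fin N → ℝ, v ≠ 0 → 0 < ∑ x, ∑ y, v x * G x y * v y)
    (schur : (PhaseSpace N → ℝ) → (PhaseSpace N → ℝ) → ℝ)
    (hschur : ∀ f g, schur f g = lap s f g - ∑ u, ∑ v, lap s f (e u) * G⁻¹ u v * lap s (e v) g)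
    {g : PhaseSpace N → ℝ} (hg : Adm g) : 0 ≤ schur g g := by
  classical
  have hex : ∀ x, Adm (e x) := fun x => adm_e Adm hAdm e he hω hl hβ hT x
  have hGsym : ∀ x y, G x y = G y x := fun x y => by
    rw [hG, hG, pkg_G_symm hAdm hlap he hFI hω hl hβ hT s]
  have hGpd : G.PosDef := posDef_of_symm_of_pos G hGsym hGp
  have hGunit : IsUnit G.det := (Matrix.isUnit_iff_isUnit_det G).mp hGpd.isUnit
  -- the optimal coefficients
  set b' : Fin N → ℝ := fun v => lap s (e v) g with hb'
  set a : Fin N → ℝ := -(G⁻¹ *ᵥ b') with ha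
  have hGa : G *ᵥ a = -b' := by
    rw [ha, Matrix.mulVec_neg, Matrix.mulVec_mulVec, Matrix.mul_nonsing_inv G hGunit, Matrix.one_mulVec]
  have hGa' : ∀ u, ∑ v, G u v * a v = -b' u := fun u => by
    have := congrFun hGa u
    simpa [Matrix.mulVec, dotProduct] using this
  -- the combination `U = g + Σ a_u e_u`
  set U : PhaseSpace N → ℝ := fun z => g z + ∑ u, a u * e u z with hU
  have hUs : Adm (fun z => ∑ u, a u * e u z) :=
    adm_sum Adm hAdm Finset.univ (fun u z => a u * e u z) (adm_const Adm hAdm hω hl hβ hT 0)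
      fun u _ => adm_const_mul Adm hAdm (a u) (hex u)
  have hUadm : Adm U := adm_add Adm hAdm hg hUs
  -- (1) `lap_s(U,U) ≥ 0`
  have hpos : 0 ≤ lap s U U := by
    obtain ⟨hUc, C, hC0, hUb⟩ := adm_nice hAdm hUadm
    have hϑ0 : 0 < 1 / (8 * T) := by positivity
    have h2ϑ : 2 * (1 / (8 * T)) < 1 / T := by
      rw [show 2 * (1 / (8 * T)) = 1 / (4 * T) by ring]
      exact one_div_lt_one_div_of_lt hT (by linarith)
    rw [hlap]
    simp only [hcorr]
    rw [pinnedChain_lap_self_eq_centred hω hl hβ' hγ' hN hT hϑ0 h2ϑ hUc hC0 hUb hs]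
    set m : ℝ := ∫ w, U w ∂(pinnedChain ω₂ lam β γ).gibbsMeasure N T with hm
    have hvc : Continuous fun z => U z - m := hUc.sub continuous_const
    have hvb : ∀ y, |U y - m| ≤ (C + |m|) * Real.exp ((1 / (8 * T)) * (pinnedChain ω₂ lam β γ).hamiltonian N y) :=
      fun y => by
      have h1 := hUb y
      have h2 : |m| ≤ |m| * Real.exp ((1 / (8 * T)) * (pinnedChain ω₂ lam β γ).hamiltonian N y) :=
        le_mul_of_one_le_right (abs_nonneg _)
          (Real.one_le_exp (mul_nonneg hϑ0.le (pinnedChain_hamiltonian_nonneg hω.le hl hβ γ N y)))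
      calc |U y - m| ≤ |U y| + |m| := abs_sub _ _
        _ ≤ _ := by rw [add_mul]; exact add_le_add h1 h2
    have hC1 : 0 ≤ C + |m| := by positivity
    have hge := pinnedChain_integral_mul_resolvent_ge hω hl hβ' hγ' hN hT hϑ0 h2ϑ hvc hC1 hvb hs
    have hsq : 0 ≤ s * ∫ z, (∫ t in Set.Ioi (0 : ℝ), Real.exp (-(s * t)) *
        ∫ y, (U y - m) ∂((pinnedChain ω₂ lam β γ).transitionKernel N T T t.toNNReal z)) ^ 2
        ∂(pinnedChain ω₂ lam β γ).gibbsMeasure N T :=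
      mul_nonneg hs.le (integral_nonneg fun z => sq_nonneg _)
    exact hsq.trans hge
  -- (2) `lap_s(U,U) = schur_s(g,g)` by bilinearity and `G a = -b'`
  have hexp : lap s U U = schur g g := by
    have hL1 : lap s U U = lap s g U + ∑ u, a u * lap s (e u) U := by
      rw [hU, lap_add_left hcorr hlap hFI hg hUs hUadm hs.le,
        lap_sum_left hAdm hcorr hlap hFI hω hl hβ hT Finset.univ a e (fun u _ => hex u) hUadm hs.le]
    have hR : ∀ {f : PhaseSpace N → ℝ}, Adm f → lap s f U = lap s f g + ∑ v, a v * lap s f (e v) := by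
      intro f hf
      have hfun : U = fun z => g z + (fun w => ∑ v, a v * e v w) z := rfl
      rw [hfun]
      -- additivity in the second slot via time reversal
      rw [lap_rev hlap hFI hf (adm_add Adm hAdm hg hUs)]
      have hsplit : (fun z : PhaseSpace N => g (z.1, -z.2) + (fun w : PhaseSpace N => ∑ v, a v * e v w) (z.1, -z.2)) =
          fun z => (fun w : PhaseSpace N => g (w.1, -w.2)) z +
            (fun w : PhaseSpace N => ∑ v, a v * e v (w.1, -w.2)) z := rfl
      rw [hsplit, lap_add_left hcorr hlap hFI (adm_rev Adm hAdm hg) ?_ (adm_rev Adm hAdm hf) hs.le]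
      · rw [← lap_rev hlap hFI hf hg]
        congr 1
        rw [lap_sum_left hAdm hcorr hlap hFI hω hl hβ hT Finset.univ a (fun v w => e v (w.1, -w.2))
          (fun v _ => adm_rev Adm hAdm (hex v)) (adm_rev Adm hAdm hf) hs.le]
        refine Finset.sum_congr rfl fun v _ => ?_
        rw [← lap_rev hlap hFI hf (hex v)]
      · exact adm_sum Adm hAdm Finset.univ (fun v w => a v * e v (w.1, -w.2)) (adm_const Adm hAdm hω hl hβ hT 0)
          fun v _ => adm_const_mul Adm hAdm (a v) (adm_rev Adm hAdm (hex v))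
    rw [hL1, hR hg]
    simp only [hR (hex _), ← hG]
    -- Σ_u a_u (b'_u... ) bookkeeping
    have hquad : ∑ u, a u * (lap s (e u) g + ∑ v, a v * G u v) = 0 := by
      have : ∀ u, lap s (e u) g + ∑ v, a v * G u v = 0 := fun u => by
        have h := hGa' u
        have h' : ∑ v, a v * G u v = ∑ v, G u v * a v := Finset.sum_congr rfl fun v _ => mul_comm _ _
        rw [h', h, hb']
        ring
      simp [this]
    rw [hquad, add_zero, hschur, sub_eq_add_neg, ← Finset.sum_neg_distrib]
    congr 1
    refine Finset.sum_congr rfl fun u _ => ?_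
    have hau : a u = -∑ v, G⁻¹ u v * lap s (e v) g := by
      simp [ha, hb', Matrix.mulVec, dotProduct]
    rw [hau, neg_mul, Finset.sum_mul]
    congr 1
    exact Finset.sum_congr rfl fun v _ => by ring
  rw [← hexp]
  exact hpos

end FixedN



/-! ### Elementary bookkeeping -/

/-- The Robin form of the constant profile has only the two contact terms: `Σ_i ([i=0] + [i=N−1]) = 2` (`N ≥ 2`). -/
theorem sum_boundary_indicator {N : ℕ} (hN : 2 ≤ N) :
    (∑ i : Fin N, ((if i.val = 0 then (1 : ℝ) else 0) + (if i.val = N - 1 then (1 : ℝ) else 0))) = 2 := by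
  rw [Finset.sum_add_distrib, sum_ite_val_eq 0 (by omega) (fun _ => (1 : ℝ)),
    sum_ite_val_eq (N - 1) (by omega) (fun _ => (1 : ℝ))]
  norm_num

/-- No room below a ceiling: if `a ≤ s·V + b` for all small `s > 0` then `a ≤ b`. -/
theorem le_of_forall_small {a b s₀ : ℝ} (hs₀ : 0 < s₀) (h : ∃ V : ℝ, ∀ s : ℝ, 0 < s → s < s₀ → a ≤ s * V + b) :
    a ≤ b := by
  obtain ⟨V, hV⟩ := h
  by_contra hlt
  push Not at hlt
  set ε : ℝ := a - b with hε
  have hε0 : 0 < ε := by rw [hε]; linarith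
  set s : ℝ := min (s₀ / 2) (ε / (|V| + 1)) with hsdef
  have hs0 : 0 < s := lt_min (by linarith) (div_pos hε0 (by positivity))
  have hs1 : s < s₀ := (min_le_left _ _).trans_lt (by linarith)
  have hs2 : s * |V| < ε := by
    have hle : s ≤ ε / (|V| + 1) := min_le_right _ _
    have hV0 : 0 ≤ |V| := abs_nonneg _
    calc s * |V| ≤ ε / (|V| + 1) * |V| := mul_le_mul_of_nonneg_right hle hV0
      _ < ε := by
        rw [div_mul_eq_mul_div, div_lt_iff₀ (by positivity)]
        nlinarith
  have h1 := hV s hs0 hs1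
  have h3 : s * V ≤ s * |V| := mul_le_mul_of_nonneg_left (le_abs_self V) hs0.le
  linarith

/-! ### The crux at fixed parameters -/

/-- The matrix inequality of `RobinCoercivity` at fixed parameters `(ω₂, lam, β, γ, T)`, constant `c`, length `N` and
Laplace threshold `s₀` — the crux's tail, verbatim. -/
def RobinBody (ω₂ lam β γ T c : ℝ) (N : ℕ) (s₀ : ℝ) : Prop :=
    let P := Literature.MathematicalPhysics.KineticTheory.HeatConduction.pinnedChain ω₂ lam β γ;
    let X := Literature.MathematicalPhysics.KineticTheory.HeatConduction.PhaseSpace N;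
    let μ : MeasureTheory.Measure X := P.gibbsMeasure N T;
    let corr : (X → ℝ) → (X → ℝ) → ℝ → ℝ := fun f g t => (∫ z, f z * (∫ y, g y ∂(P.transitionKernel N T T t.toNNReal z)) ∂μ) - (∫ z, f z ∂μ) * (∫ z, g z ∂μ);
    let lap : ℝ → (X → ℝ) → (X → ℝ) → ℝ := fun s f g => ∫ t in Set.Ioi (0 : ℝ), Real.exp (-(s * t)) * corr f g t;
    let cov : (X → ℝ) → (X → ℝ) → ℝ := fun f g => (∫ z, f z * g z ∂μ) - (∫ z, f z ∂μ) * (∫ z, g z ∂μ);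
    let e : Fin N → X → ℝ := fun x z => z.2 x ^ 2 / 2 + P.U (z.1 x) + ∑ j : Fin N, ((if j.val = x.val + 1 then P.V (z.1 j - z.1 x) / 2 else 0) + (if x.val = j.val + 1 then P.V (z.1 x - z.1 j) / 2 else 0));
    let G : ℝ → Matrix (Fin N) (Fin N) ℝ := fun s => Matrix.of fun x y => lap s (e x) (e y);
    let schur : ℝ → (X → ℝ) → (X → ℝ) → ℝ := fun s f g => lap s f g - ∑ x : Fin N, ∑ y : Fin N, lap s f (e x) * (G s)⁻¹ x y * lap s (e y) g;
    let F : ℝ → Fin N → Fin N → ℝ := fun s x y => s * cov (e x) (e y) - cov (e x) (P.generator N T T (e y)) - schur s (fun z => P.generator N T T (e x) (z.1, -z.2)) (P.generator N T T (e y));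
    ∀ s : ℝ, 0 < s → s < s₀ → ∀ ξ : Fin N → ℝ, c * (∑ i : Fin N, ((∑ j : Fin N, if j.val = i.val + 1 then (ξ j - ξ i) ^ 2 else 0) + (if i.val = 0 then ξ i ^ 2 else 0) + (if i.val = N - 1 then ξ i ^ 2 else 0))) ≤ ∑ x : Fin N, ∑ y : Fin N, ξ x * F s x y * ξ y

/-- `RobinCoercivity` at fixed parameters with a GIVEN constant `c`: for every `N ≥ 2` some threshold `s₀ > 0` works. -/
def RobinCoercivityAt (ω₂ lam β γ T c : ℝ) : Prop :=
  ∀ N : ℕ, 2 ≤ N → ∃ s₀ : ℝ, 0 < s₀ ∧ RobinBody ω₂ lam β γ T c N s₀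

/-- The crux is, definitionally, "for all positive parameters some positive constant is admissible". -/
theorem robinCoercivity_iff :
    RobinCoercivity ↔ ∀ ω₂ lam β γ : ℝ, 0 < ω₂ → 0 < lam → 0 < β → 0 < γ → ∀ T : ℝ, 0 < T →
      ∃ c : ℝ, 0 < c ∧ RobinCoercivityAt ω₂ lam β γ T c :=
  Iff.rfl

/-! ### Two sites, no baths: the Feshbach matrix sums to its static part -/

section TwoSites

variable {ω₂ lam β : ℝ} {T : ℝ}
  {corr : (PhaseSpace 2 → ℝ) → (PhaseSpace 2 → ℝ) → ℝ → ℝ}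
  {lap : ℝ → (PhaseSpace 2 → ℝ) → (PhaseSpace 2 → ℝ) → ℝ}
  {cov : (PhaseSpace 2 → ℝ) → (PhaseSpace 2 → ℝ) → ℝ}
  {e : Fin 2 → PhaseSpace 2 → ℝ}
  (hcorr : ∀ f g t, corr f g t =
    (∫ z, f z * (∫ y, g y ∂((pinnedChain ω₂ lam β 0).transitionKernel 2 T T t.toNNReal z))
      ∂(pinnedChain ω₂ lam β 0).gibbsMeasure 2 T) -
    (∫ z, f z ∂(pinnedChain ω₂ lam β 0).gibbsMeasure 2 T) *
      (∫ z, g z ∂(pinnedChain ω₂ lam β 0).gibbsMeasure 2 T))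
  (hlap : ∀ s f g, lap s f g = ∫ t in Set.Ioi (0 : ℝ), Real.exp (-(s * t)) * corr f g t)
  (hcov : ∀ f g, cov f g = (∫ z, f z * g z ∂(pinnedChain ω₂ lam β 0).gibbsMeasure 2 T) -
    (∫ z, f z ∂(pinnedChain ω₂ lam β 0).gibbsMeasure 2 T) *
      (∫ z, g z ∂(pinnedChain ω₂ lam β 0).gibbsMeasure 2 T))
  (hGSE : ∀ (x : Fin 2) (z : PhaseSpace 2), (pinnedChain ω₂ lam β 0).generator 2 T T (e x) z =
    (∑ b : Fin 2, ((if x.val = b.val + 1 then (pinnedChain ω₂ lam β 0).bondCurrent 2 b z else 0) -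
      (if b = x then (pinnedChain ω₂ lam β 0).bondCurrent 2 b z else 0))) +
    (if x.val = 0 then (pinnedChain ω₂ lam β 0).γ * (T - z.2 x ^ 2) else 0) +
    (if x.val = 2 - 1 then (pinnedChain ω₂ lam β 0).γ * (T - z.2 x ^ 2) else 0))

include hcov in
/-- `cov(f, −g) = −cov(f, g)` (no integrability needed). -/
theorem cov_neg_right (f g : PhaseSpace 2 → ℝ) : cov f (fun z => -g z) = -cov f g := by
  rw [hcov, hcov]
  have h1 : (fun z => f z * -g z) = fun z => -(f z * g z) := funext fun z => by ring
  rw [h1, integral_neg, integral_neg]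
  ring

include hcorr hlap in
/-- `schur_s(f, c·g) = c·schur_s(f, g)` for the Schur pairing built on `lap_s` (no integrability needed). -/
theorem schur_const_mul_right (s : ℝ) (G : Matrix (Fin 2) (Fin 2) ℝ)
    (schur : (PhaseSpace 2 → ℝ) → (PhaseSpace 2 → ℝ) → ℝ)
    (hschur : ∀ f g, schur f g = lap s f g - ∑ u, ∑ v, lap s f (e u) * G⁻¹ u v * lap s (e v) g)
    (c : ℝ) (f g : PhaseSpace 2 → ℝ) : schur f (fun z => c * g z) = c * schur f g := by
  rw [hschur, hschur]
  simp only [lap_const_mul_right hcorr hlap, mul_sub, Finset.mul_sum]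
  congr 1
  exact Finset.sum_congr rfl fun u _ => Finset.sum_congr rfl fun v _ => by ring

include hcorr hlap in
/-- `schur_s(c·f, g) = c·schur_s(f, g)`. -/
theorem schur_const_mul_left (s : ℝ) (G : Matrix (Fin 2) (Fin 2) ℝ)
    (schur : (PhaseSpace 2 → ℝ) → (PhaseSpace 2 → ℝ) → ℝ)
    (hschur : ∀ f g, schur f g = lap s f g - ∑ u, ∑ v, lap s f (e u) * G⁻¹ u v * lap s (e v) g)
    (c : ℝ) (f g : PhaseSpace 2 → ℝ) : schur (fun z => c * f z) g = c * schur f g := by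
  rw [hschur, hschur]
  simp only [lap_const_mul_left hcorr hlap, mul_sub, Finset.mul_sum]
  congr 1
  exact Finset.sum_congr rfl fun u _ => Finset.sum_congr rfl fun v _ => by ring

include hcorr hlap in
/-- `schur_s(f, −g) = −schur_s(f, g)`. -/
theorem schur_neg_right (s : ℝ) (G : Matrix (Fin 2) (Fin 2) ℝ)
    (schur : (PhaseSpace 2 → ℝ) → (PhaseSpace 2 → ℝ) → ℝ)
    (hschur : ∀ f g, schur f g = lap s f g - ∑ u, ∑ v, lap s f (e u) * G⁻¹ u v * lap s (e v) g)
    (f g : PhaseSpace 2 → ℝ) : schur f (fun z => -g z) = -schur f g := by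
  rw [show (fun z => -g z) = (fun z => (-1 : ℝ) * g z) from funext fun z => by ring,
    schur_const_mul_right hcorr hlap s G schur hschur]
  ring

include hcorr hlap in
/-- `schur_s(−f, g) = −schur_s(f, g)`. -/
theorem schur_neg_left (s : ℝ) (G : Matrix (Fin 2) (Fin 2) ℝ)
    (schur : (PhaseSpace 2 → ℝ) → (PhaseSpace 2 → ℝ) → ℝ)
    (hschur : ∀ f g, schur f g = lap s f g - ∑ u, ∑ v, lap s f (e u) * G⁻¹ u v * lap s (e v) g)
    (f g : PhaseSpace 2 → ℝ) : schur (fun z => -f z) g = -schur f g := by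
  rw [show (fun z => -f z) = (fun z => (-1 : ℝ) * f z) from funext fun z => by ring,
    schur_const_mul_left hcorr hlap s G schur hschur]
  ring

include hGSE in
/-- With no baths the generator images of the two split site energies are opposite bond currents:
`L e_0 = −j_0`, `L e_1 = +j_0` (`j_1 ≡ 0`). -/
theorem generator_splitSite_two_nocoupling :
    (pinnedChain ω₂ lam β 0).generator 2 T T (e 0) = (fun z => -(pinnedChain ω₂ lam β 0).bondCurrent 2 0 z) ∧
    (pinnedChain ω₂ lam β 0).generator 2 T T (e 1) = (pinnedChain ω₂ lam β 0).bondCurrent 2 0 := by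
  have hγ0 : (pinnedChain ω₂ lam β 0).γ = 0 := rfl
  have hj1 : ∀ z, (pinnedChain ω₂ lam β 0).bondCurrent 2 1 z = 0 := fun z =>
    bondCurrent_eq_zero_of_last _ 1 (by decide) z
  refine ⟨funext fun z => ?_, funext fun z => ?_⟩
  · rw [hGSE]
    simp [hγ0]
  · rw [hGSE]
    simp [hγ0, hj1]

include hcorr hlap hcov hGSE in
/-- **Two sites, no baths**: `Σ_x Σ_y 𝔽_2(s)_{xy} = s·Σ_x Σ_y Cov(e_x, e_y)` — the contact and memory blocks cancel in
pairs because `L e_0 = −L e_1` and `L†e_0 = −L†e_1`. -/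
theorem sum_sum_feshbach_two_nocoupling (s : ℝ) (G : Matrix (Fin 2) (Fin 2) ℝ)
    (schur : (PhaseSpace 2 → ℝ) → (PhaseSpace 2 → ℝ) → ℝ)
    (hschur : ∀ f g, schur f g = lap s f g - ∑ u, ∑ v, lap s f (e u) * G⁻¹ u v * lap s (e v) g)
    (F : Fin 2 → Fin 2 → ℝ)
    (hF : ∀ x y, F x y = s * cov (e x) (e y) - cov (e x) ((pinnedChain ω₂ lam β 0).generator 2 T T (e y)) -
      schur (fun z => (pinnedChain ω₂ lam β 0).generator 2 T T (e x) (z.1, -z.2))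
        ((pinnedChain ω₂ lam β 0).generator 2 T T (e y))) :
    ∑ x, ∑ y, F x y = s * ∑ x, ∑ y, cov (e x) (e y) := by
  obtain ⟨h0, h1⟩ := generator_splitSite_two_nocoupling hGSE
  simp only [Fin.sum_univ_two, hF]
  rw [h0, h1]
  simp only [OscillatorChain.bondCurrent_neg_momentum, neg_neg, cov_neg_right hcov,
    schur_neg_right hcorr hlap s G schur hschur, schur_neg_left hcorr hlap s G schur hschur]
  ring

end TwoSites

/-! ### The coupling is load-bearing -/

/-- The crux with the bath coupling allowed to vanish: `0 < γ` weakened to `0 ≤ γ`, everything else verbatim. -/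
def RobinCoercivityNonnegCoupling : Prop :=
  ∀ ω₂ lam β γ : ℝ, 0 < ω₂ → 0 < lam → 0 < β → 0 ≤ γ → ∀ T : ℝ, 0 < T →
    ∃ c : ℝ, 0 < c ∧ RobinCoercivityAt ω₂ lam β γ T c

/-- **`RobinCoercivity` is false without `γ > 0`** (any proof must use the bath coupling): at `γ = 0`, `N = 2` the
Feshbach matrix sums to `s·1ᵀCov(e,e)1 → 0` against the constant profile, whose Robin form is `2`. Unconditional:
pure sign bookkeeping, `sum_sum_feshbach_two_nocoupling`. -/
theorem robinCoercivity_false_without_coupling : ¬ RobinCoercivityNonnegCoupling := by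
  intro h
  obtain ⟨c, hc, hAt⟩ := h 1 1 1 0 one_pos one_pos one_pos le_rfl 1 one_pos
  obtain ⟨s₀, hs₀, hbody⟩ := hAt 2 le_rfl
  dsimp only [RobinBody] at hbody
  have h2c : 2 * c ≤ 0 := by
    have h := le_of_forall_small (b := 0) hs₀ ⟨_, fun s hs hss => by
      have h1 := hbody s hs hss (fun _ => 1)
      simp only [sub_self, ne_eq, OfNat.ofNat_ne_zero, not_false_eq_true, zero_pow, ite_self,
        Finset.sum_const_zero, zero_add, one_pow, one_mul, mul_one] at h1
      rw [sum_boundary_indicator (le_refl 2), mul_comm] at h1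
      rw [add_zero]
      exact h1.trans_eq (sum_sum_feshbach_two_nocoupling (ω₂ := 1) (lam := 1) (β := 1) (T := 1)
        (corr := fun f g t => (∫ z, f z * (∫ y, g y ∂((pinnedChain 1 1 1 0).transitionKernel 2 1 1
          t.toNNReal z)) ∂(pinnedChain 1 1 1 0).gibbsMeasure 2 1) -
          (∫ z, f z ∂(pinnedChain 1 1 1 0).gibbsMeasure 2 1) * (∫ z, g z ∂(pinnedChain 1 1 1 0).gibbsMeasure 2 1))
        (cov := fun f g => (∫ z, f z * g z ∂(pinnedChain 1 1 1 0).gibbsMeasure 2 1) -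
          (∫ z, f z ∂(pinnedChain 1 1 1 0).gibbsMeasure 2 1) * (∫ z, g z ∂(pinnedChain 1 1 1 0).gibbsMeasure 2 1))
        (fun f g t => rfl) (fun s f g => rfl) (fun f g => rfl)
        (fun x z => generatorSiteEnergy_proof 1 1 1 0 2 le_rfl 1 1 x z) s _ _ (fun f g => rfl) _ (fun x y => rfl))⟩
    exact h
  linarith



/-! ### Fixed `N`, fixed `s` (gadgets as in part 1) -/

section FixedN

variable {ω₂ lam β γ : ℝ} {N : ℕ} {T : ℝ}
  {Adm : (PhaseSpace N → ℝ) → Prop}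
  {corr : (PhaseSpace N → ℝ) → (PhaseSpace N → ℝ) → ℝ → ℝ}
  {lap : ℝ → (PhaseSpace N → ℝ) → (PhaseSpace N → ℝ) → ℝ}
  {cov : (PhaseSpace N → ℝ) → (PhaseSpace N → ℝ) → ℝ}
  {e : Fin N → PhaseSpace N → ℝ}
  (hAdm : ∀ f, Adm f ↔ (Continuous f ∧ ∃ A : ℝ, ∀ z,
    |f z| ≤ A * Real.exp ((pinnedChain ω₂ lam β γ).hamiltonian N z / (8 * T))))
  (hcorr : ∀ f g t, corr f g t =
    (∫ z, f z * (∫ y, g y ∂((pinnedChain ω₂ lam β γ).transitionKernel N T T t.toNNReal z))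
      ∂(pinnedChain ω₂ lam β γ).gibbsMeasure N T) -
    (∫ z, f z ∂(pinnedChain ω₂ lam β γ).gibbsMeasure N T) *
      (∫ z, g z ∂(pinnedChain ω₂ lam β γ).gibbsMeasure N T))
  (hlap : ∀ s f g, lap s f g = ∫ t in Set.Ioi (0 : ℝ), Real.exp (-(s * t)) * corr f g t)
  (hcov : ∀ f g, cov f g = (∫ z, f z * g z ∂(pinnedChain ω₂ lam β γ).gibbsMeasure N T) -
    (∫ z, f z ∂(pinnedChain ω₂ lam β γ).gibbsMeasure N T) *
      (∫ z, g z ∂(pinnedChain ω₂ lam β γ).gibbsMeasure N T))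
  (he : ∀ x z, e x z = z.2 x ^ 2 / 2 + (pinnedChain ω₂ lam β γ).U (z.1 x) +
    ∑ j : Fin N, ((if j.val = x.val + 1 then (pinnedChain ω₂ lam β γ).V (z.1 j - z.1 x) / 2 else 0) +
      (if x.val = j.val + 1 then (pinnedChain ω₂ lam β γ).V (z.1 x - z.1 j) / 2 else 0)))
  (hFI : ∀ f g : PhaseSpace N → ℝ, Adm f → Adm g →
    Integrable f ((pinnedChain ω₂ lam β γ).gibbsMeasure N T) ∧
    (∀ t : ℝ, 0 ≤ t → Integrable (fun z => f z *
      (∫ y, g y ∂((pinnedChain ω₂ lam β γ).transitionKernel N T T t.toNNReal z)))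
      ((pinnedChain ω₂ lam β γ).gibbsMeasure N T)) ∧
    IntegrableOn (corr f g) (Set.Ioi 0) ∧
    (∀ t : ℝ, 0 ≤ t → corr f g t = corr (fun z => g (z.1, -z.2)) (fun z => f (z.1, -z.2)) t) ∧
    (∀ s : ℝ, 0 < s → ∀ x : Fin N,
      s * lap s (e x) g - cov (e x) g =
        lap s (fun z => (pinnedChain ω₂ lam β γ).generator N T T (e x) (z.1, -z.2)) g ∧
      s * lap s f (e x) - cov f (e x) = lap s f ((pinnedChain ω₂ lam β γ).generator N T T (e x))))
  (hGSE : ∀ (x : Fin N) (z : PhaseSpace N), (pinnedChain ω₂ lam β γ).generator N T T (e x) z =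
    (∑ b : Fin N, ((if x.val = b.val + 1 then (pinnedChain ω₂ lam β γ).bondCurrent N b z else 0) -
      (if b = x then (pinnedChain ω₂ lam β γ).bondCurrent N b z else 0))) +
    (if x.val = 0 then (pinnedChain ω₂ lam β γ).γ * (T - z.2 x ^ 2) else 0) +
    (if x.val = N - 1 then (pinnedChain ω₂ lam β γ).γ * (T - z.2 x ^ 2) else 0))
  (hPS : ∀ x y : Fin N, cov (e x) ((pinnedChain ω₂ lam β γ).generator N T T (e y)) =
    -(if x = y ∧ (x.val = 0 ∨ x.val = N - 1) then (pinnedChain ω₂ lam β γ).γ * T ^ 2 else 0))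
  (hω : 0 < ω₂) (hl : 0 ≤ lam) (hβ : 0 ≤ β) (hγ : 0 ≤ γ) (hT : 0 < T)

include hGSE in
/-- The generator images of the split site energies telescope to the bath heating terms:
`Σ_x (L e_x)(z) = γ(T − p_0²) + γ(T − p_{N−1}²)` (`N ≥ 2`; the last bond carries no current). -/
theorem sum_generator_splitSite (hN : 2 ≤ N) (z : PhaseSpace N) :
    ∑ x, (pinnedChain ω₂ lam β γ).generator N T T (e x) z =
      (pinnedChain ω₂ lam β γ).γ * (T - z.2 ⟨0, by omega⟩ ^ 2) +
        (pinnedChain ω₂ lam β γ).γ * (T - z.2 ⟨N - 1, by omega⟩ ^ 2) := by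
  simp only [hGSE, Finset.sum_add_distrib, Finset.sum_sub_distrib]
  have h1 : ∑ x : Fin N, ∑ b : Fin N,
      (if x.val = b.val + 1 then (pinnedChain ω₂ lam β γ).bondCurrent N b z else 0) =
      ∑ b : Fin N, (pinnedChain ω₂ lam β γ).bondCurrent N b z := by
    rw [Finset.sum_comm]
    refine Finset.sum_congr rfl fun b _ => ?_
    by_cases hb : b.val + 1 < N
    · exact sum_ite_succ_eq (fun _ => (pinnedChain ω₂ lam β γ).bondCurrent N b z) b hb
    · rw [sum_ite_succ_eq_zero (fun _ => (pinnedChain ω₂ lam β γ).bondCurrent N b z) b hb,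
        bondCurrent_eq_zero_of_last _ b hb z]
  have h2 : ∑ x : Fin N, ∑ b : Fin N, (if b = x then (pinnedChain ω₂ lam β γ).bondCurrent N b z else 0) =
      ∑ b : Fin N, (pinnedChain ω₂ lam β γ).bondCurrent N b z := by
    rw [Finset.sum_comm]
    refine Finset.sum_congr rfl fun b _ => ?_
    rw [Finset.sum_ite_eq]
    simp
  rw [h1, h2, sub_self, zero_add,
    sum_ite_val_eq 0 (by omega) (fun x => (pinnedChain ω₂ lam β γ).γ * (T - z.2 x ^ 2)),
    sum_ite_val_eq (N - 1) (by omega) (fun x => (pinnedChain ω₂ lam β γ).γ * (T - z.2 x ^ 2))]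

include hPS in
/-- The static block against the constant profile: `Σ_x Σ_y Cov(e_x, L e_y) = −2γT²` (`ParityStatics`, `N ≥ 2`). -/
theorem sum_sum_cov_generator (hN : 2 ≤ N) :
    ∑ x, ∑ y, cov (e x) ((pinnedChain ω₂ lam β γ).generator N T T (e y)) =
      -(2 * ((pinnedChain ω₂ lam β γ).γ * T ^ 2)) := by
  simp only [hPS]
  have h1 : ∀ x : Fin N, ∑ y : Fin N,
      -(if x = y ∧ (x.val = 0 ∨ x.val = N - 1) then (pinnedChain ω₂ lam β γ).γ * T ^ 2 else 0) =
      -((if x.val = 0 then (pinnedChain ω₂ lam β γ).γ * T ^ 2 else 0) +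
        (if x.val = N - 1 then (pinnedChain ω₂ lam β γ).γ * T ^ 2 else 0)) := by
    intro x
    rw [Finset.sum_neg_distrib, Finset.sum_eq_single x]
    · congr 1
      have hx := x.isLt
      by_cases h0 : x.val = 0
      · have h1 : ¬ x.val = N - 1 := by omega
        rw [if_pos ⟨rfl, Or.inl h0⟩, if_pos h0, if_neg h1, add_zero]
      · by_cases h1 : x.val = N - 1
        · rw [if_pos ⟨rfl, Or.inr h1⟩, if_neg h0, if_pos h1, zero_add]
        · rw [if_neg (fun h => h.2.elim h0 h1), if_neg h0, if_neg h1, add_zero]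
    · intro y _ hyx
      rw [if_neg (fun h => hyx h.1.symm)]
    · intro h
      exact absurd (Finset.mem_univ x) h
  simp only [h1, Finset.sum_neg_distrib, Finset.sum_add_distrib]
  rw [sum_ite_val_eq 0 (by omega) (fun _ => (pinnedChain ω₂ lam β γ).γ * T ^ 2),
    sum_ite_val_eq (N - 1) (by omega) (fun _ => (pinnedChain ω₂ lam β γ).γ * T ^ 2)]
  ring

include hAdm hcorr hlap hFI he hGSE hPS hω hl hβ hT in
/-- **The contact ceiling at fixed `N` and `s`.** Under the fixed-`N` package, for `N ≥ 2`, `s > 0`, `β, γ > 0` and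
`G(s)` with positive quadratic form: `Σ_x Σ_y 𝔽_N(s)_{xy} ≤ s·Σ_x Σ_y Cov(e_x,e_y) + 2γT²` — against the total energy the
memory term `schur_s(L†H, LH) = schur_s(w, w)`, `w = γ(T − p_0²) + γ(T − p_{N−1}²)`, is nonnegative. -/
theorem sum_sum_feshbach_le (hβ' : 0 < β) (hγ' : 0 < γ) (hN : 2 ≤ N) {s : ℝ} (hs : 0 < s)
    (G : Matrix (Fin N) (Fin N) ℝ) (hG : ∀ x y, G x y = lap s (e x) (e y))
    (hGp : ∀ v : Fin N → ℝ, v ≠ 0 → 0 < ∑ x, ∑ y, v x * G x y * v y)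
    (schur : (PhaseSpace N → ℝ) → (PhaseSpace N → ℝ) → ℝ)
    (hschur : ∀ f g, schur f g = lap s f g - ∑ u, ∑ v, lap s f (e u) * G⁻¹ u v * lap s (e v) g)
    (F : Fin N → Fin N → ℝ)
    (hF : ∀ x y, F x y = s * cov (e x) (e y) - cov (e x) ((pinnedChain ω₂ lam β γ).generator N T T (e y)) -
      schur (fun z => (pinnedChain ω₂ lam β γ).generator N T T (e x) (z.1, -z.2))
        ((pinnedChain ω₂ lam β γ).generator N T T (e y))) :
    ∑ x, ∑ y, F x y ≤ s * (∑ x, ∑ y, cov (e x) (e y)) + 2 * ((pinnedChain ω₂ lam β γ).γ * T ^ 2) := by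
  have hN0 : 0 < N := by omega
  have hLf : ∀ x, Adm ((pinnedChain ω₂ lam β γ).generator N T T (e x)) :=
    fun x => adm_generator_e hAdm hGSE hω hl hβ hT x
  have hLr : ∀ x, Adm (fun z => (pinnedChain ω₂ lam β γ).generator N T T (e x) (z.1, -z.2)) :=
    fun x => adm_rev Adm hAdm (hLf x)
  -- the bath heating observable `w`
  set w : PhaseSpace N → ℝ := fun z => (pinnedChain ω₂ lam β γ).γ * (T - z.2 ⟨0, by omega⟩ ^ 2) +
    (pinnedChain ω₂ lam β γ).γ * (T - z.2 ⟨N - 1, by omega⟩ ^ 2) with hw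
  have hw_adm : Adm w :=
    adm_add Adm hAdm
      (adm_const_mul Adm hAdm _ (adm_sub Adm hAdm (adm_const Adm hAdm hω hl hβ hT T) (adm_psq Adm hAdm hω hl hβ hT _)))
      (adm_const_mul Adm hAdm _ (adm_sub Adm hAdm (adm_const Adm hAdm hω hl hβ hT T) (adm_psq Adm hAdm hω hl hβ hT _)))
  have hgsum : (fun z => ∑ y, (pinnedChain ω₂ lam β γ).generator N T T (e y) z) = w :=
    funext fun z => sum_generator_splitSite hGSE hN z
  have hfsum : (fun z => ∑ x, (pinnedChain ω₂ lam β γ).generator N T T (e x) (z.1, -z.2)) = w := by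
    funext z
    rw [sum_generator_splitSite hGSE hN (z.1, -z.2), hw]
    simp only [Pi.neg_apply, neg_sq]
  -- the three blocks
  have hschurSum : ∑ x, ∑ y, schur (fun z => (pinnedChain ω₂ lam β γ).generator N T T (e x) (z.1, -z.2))
      ((pinnedChain ω₂ lam β γ).generator N T T (e y)) = schur w w := by
    rw [sum_sum_schur_eq_schur_sum hAdm hcorr hlap he hFI hω hl hβ hT hs.le G schur hschur Finset.univ Finset.univ
      (fun x z => (pinnedChain ω₂ lam β γ).generator N T T (e x) (z.1, -z.2))
      (fun y => (pinnedChain ω₂ lam β γ).generator N T T (e y)) (fun x _ => hLr x) (fun y _ => hLf y)]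
    rw [hfsum]
    exact congrArg _ hgsum
  have hnonneg : 0 ≤ schur w w :=
    schur_self_nonneg hAdm hcorr hlap he hFI hω hl hβ hT hβ' hγ' hN0 hs G hG hGp schur hschur hw_adm
  have hcovSum := sum_sum_cov_generator (cov := cov) (e := e) hPS hN
  simp only [hF, Finset.sum_sub_distrib]
  rw [hschurSum, hcovSum]
  have hmul : ∑ x, ∑ y, s * cov (e x) (e y) = s * ∑ x, ∑ y, cov (e x) (e y) := by
    rw [Finset.mul_sum]
    exact Finset.sum_congr rfl fun x _ => by rw [Finset.mul_sum]
  rw [hmul]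
  linarith

end FixedN

/-! ### At the route's objects (`RobinBody`, `RobinCoercivityAt` from `…Negative.WithoutCoupling`) -/

/-- **The contact ceiling** (modulo the route's support item `FeshbachIdentities`): for all positive parameters, `T > 0`,
`N ≥ 2` and EVERY `s > 0`, `1ᵀ𝔽_N(s)1 = Σ_x Σ_y 𝔽_N(s)_{xy} ≤ s·Σ_x Σ_y Cov(e_x,e_y) + 2γT²`. -/
theorem one_feshbach_one_le (hFI : FeshbachIdentities) :
    ∀ ω₂ lam β γ : ℝ, 0 < ω₂ → 0 < lam → 0 < β → 0 < γ → ∀ T : ℝ, 0 < T → ∀ N : ℕ, 2 ≤ N →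
    let P := Literature.MathematicalPhysics.KineticTheory.HeatConduction.pinnedChain ω₂ lam β γ;
    let X := Literature.MathematicalPhysics.KineticTheory.HeatConduction.PhaseSpace N;
    let μ : MeasureTheory.Measure X := P.gibbsMeasure N T;
    let corr : (X → ℝ) → (X → ℝ) → ℝ → ℝ := fun f g t => (∫ z, f z * (∫ y, g y ∂(P.transitionKernel N T T t.toNNReal z)) ∂μ) - (∫ z, f z ∂μ) * (∫ z, g z ∂μ);
    let lap : ℝ → (X → ℝ) → (X → ℝ) → ℝ := fun s f g => ∫ t in Set.Ioi (0 : ℝ), Real.exp (-(s * t)) * corr f g t;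
    let cov : (X → ℝ) → (X → ℝ) → ℝ := fun f g => (∫ z, f z * g z ∂μ) - (∫ z, f z ∂μ) * (∫ z, g z ∂μ);
    let e : Fin N → X → ℝ := fun x z => z.2 x ^ 2 / 2 + P.U (z.1 x) + ∑ j : Fin N, ((if j.val = x.val + 1 then P.V (z.1 j - z.1 x) / 2 else 0) + (if x.val = j.val + 1 then P.V (z.1 x - z.1 j) / 2 else 0));
    let G : ℝ → Matrix (Fin N) (Fin N) ℝ := fun s => Matrix.of fun x y => lap s (e x) (e y);
    let schur : ℝ → (X → ℝ) → (X → ℝ) → ℝ := fun s f g => lap s f g - ∑ x : Fin N, ∑ y : Fin N, lap s f (e x) * (G s)⁻¹ x y * lap s (e y) g;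
    let F : ℝ → Fin N → Fin N → ℝ := fun s x y => s * cov (e x) (e y) - cov (e x) (P.generator N T T (e y)) - schur s (fun z => P.generator N T T (e x) (z.1, -z.2)) (P.generator N T T (e y));
    ∀ s : ℝ, 0 < s → ∑ x : Fin N, ∑ y : Fin N, F s x y ≤ s * (∑ x : Fin N, ∑ y : Fin N, cov (e x) (e y)) + 2 * (γ * T ^ 2) := by
  intro ω₂ lam β γ hω hl hβ hγ T hT N hN
  dsimp only
  intro s hs
  obtain ⟨-, hFI2, -, hGp⟩ := hFI ω₂ lam β γ hω hl hβ hγ T hT N hN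
  exact sum_sum_feshbach_le (ω₂ := ω₂) (lam := lam) (β := β) (γ := γ) (N := N) (T := T)
    (corr := fun f g t => (∫ z, f z * (∫ y, g y ∂((pinnedChain ω₂ lam β γ).transitionKernel N T T
      t.toNNReal z)) ∂(pinnedChain ω₂ lam β γ).gibbsMeasure N T) -
      (∫ z, f z ∂(pinnedChain ω₂ lam β γ).gibbsMeasure N T) * (∫ z, g z ∂(pinnedChain ω₂ lam β γ).gibbsMeasure N T))
    (cov := fun f g => (∫ z, f z * g z ∂(pinnedChain ω₂ lam β γ).gibbsMeasure N T) -
      (∫ z, f z ∂(pinnedChain ω₂ lam β γ).gibbsMeasure N T) * (∫ z, g z ∂(pinnedChain ω₂ lam β γ).gibbsMeasure N T))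
    (fun f => Iff.rfl) (fun f g t => rfl) (fun s f g => rfl) (fun x z => rfl)
    hFI2 (fun x z => generatorSiteEnergy_proof ω₂ lam β γ N hN T T x z)
    (fun x y => ((parityStatics_proof ω₂ lam β γ hω hl hβ hγ T hT N hN) x).2 y)
    hω hl.le hβ.le hT hβ hγ hN hs _ (fun x y => rfl) (hGp s hs) _ (fun f g => rfl) _ (fun x y => rfl)

/-- **Tightness of the constant**: every `c` admissible in `RobinCoercivity` at `(ω₂, lam, β, γ, T)` and some `N ≥ 2`
satisfies `c ≤ γT²` — the Robin constant never exceeds the bare contact conductance (test profile `ξ ≡ 1`, `s ↓ 0`). -/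
theorem robinBody_const_le (hFI : FeshbachIdentities) {ω₂ lam β γ T c : ℝ} {N : ℕ} {s₀ : ℝ} (hω : 0 < ω₂)
    (hl : 0 < lam) (hβ : 0 < β) (hγ : 0 < γ) (hT : 0 < T) (hN : 2 ≤ N) (hs₀ : 0 < s₀)
    (hbody : RobinBody ω₂ lam β γ T c N s₀) : c ≤ γ * T ^ 2 := by
  have key := one_feshbach_one_le hFI ω₂ lam β γ hω hl hβ hγ T hT N hN
  dsimp only [RobinBody] at hbody key
  have h2c : 2 * c ≤ 2 * (γ * T ^ 2) :=
    le_of_forall_small hs₀ ⟨_, fun s hs hss => by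
      have h1 := hbody s hs hss (fun _ => 1)
      simp only [sub_self, ne_eq, OfNat.ofNat_ne_zero, not_false_eq_true, zero_pow, ite_self,
        Finset.sum_const_zero, zero_add, one_pow, one_mul, mul_one] at h1
      rw [sum_boundary_indicator hN] at h1
      rw [mul_comm]
      exact h1.trans (key s hs)⟩
  linarith

/-- Every constant admissible in `RobinCoercivity` at `(ω₂, lam, β, γ, T)` is at most `γT²`. -/
theorem robinConst_le_contact (hFI : FeshbachIdentities) {ω₂ lam β γ T c : ℝ} (hω : 0 < ω₂) (hl : 0 < lam)
    (hβ : 0 < β) (hγ : 0 < γ) (hT : 0 < T) (h : RobinCoercivityAt ω₂ lam β γ T c) : c ≤ γ * T ^ 2 := by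
  obtain ⟨s₀, hs₀, hbody⟩ := h 2 le_rfl
  exact robinBody_const_le hFI hω hl hβ hγ hT le_rfl hs₀ hbody

/-- Hence the crux pins its constant below the contact conductance: `RobinCoercivity` can only hold with `c ≤ γT²`. -/
theorem robinCoercivity_const_le (hFI : FeshbachIdentities) (hRC : RobinCoercivity) {ω₂ lam β γ T : ℝ}
    (hω : 0 < ω₂) (hl : 0 < lam) (hβ : 0 < β) (hγ : 0 < γ) (hT : 0 < T) :
    ∃ c : ℝ, 0 < c ∧ c ≤ γ * T ^ 2 ∧ RobinCoercivityAt ω₂ lam β γ T c := by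
  obtain ⟨c, hc, h⟩ := (robinCoercivity_iff.mp hRC) ω₂ lam β γ hω hl hβ hγ T hT
  exact ⟨c, hc, robinConst_le_contact hFI hω hl hβ hγ hT h, h⟩

/-! ### Refuted natural strengthenings -/

/-- NATURAL STRENGTHENING 1 (refuted below): a Robin constant UNIFORM IN THE TEMPERATURE. -/
def RobinCoercivityUniformInT : Prop :=
  ∀ ω₂ lam β γ : ℝ, 0 < ω₂ → 0 < lam → 0 < β → 0 < γ → ∃ c : ℝ, 0 < c ∧ ∀ T : ℝ, 0 < T →
    RobinCoercivityAt ω₂ lam β γ T c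

/-- **No `T`-uniform Robin constant** (modulo `FeshbachIdentities`): `c ≤ γT² → 0` as `T ↓ 0`. -/
theorem not_robinCoercivityUniformInT (hFI : FeshbachIdentities) : ¬ RobinCoercivityUniformInT := by
  intro h
  obtain ⟨c, hc, hcT⟩ := h 1 1 1 1 one_pos one_pos one_pos one_pos
  set T : ℝ := min 1 (c / 2) with hTdef
  have hT0 : 0 < T := lt_min one_pos (by linarith)
  have hT1 : T ≤ 1 := min_le_left _ _
  have hT2 : T ≤ c / 2 := min_le_right _ _
  have hle := robinConst_le_contact hFI one_pos one_pos one_pos one_pos hT0 (hcT T hT0)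
  nlinarith

/-- NATURAL STRENGTHENING 2 (refuted below): a Robin constant UNIFORM IN THE BATH COUPLING `γ`. -/
def RobinCoercivityUniformInCoupling : Prop :=
  ∀ ω₂ lam β T : ℝ, 0 < ω₂ → 0 < lam → 0 < β → 0 < T → ∃ c : ℝ, 0 < c ∧ ∀ γ : ℝ, 0 < γ →
    RobinCoercivityAt ω₂ lam β γ T c

/-- **No `γ`-uniform Robin constant** (modulo `FeshbachIdentities`): `c ≤ γT² → 0` as `γ ↓ 0` (weak coupling to the
baths makes the contact conductance, hence the Robin constant, vanish). -/
theorem not_robinCoercivityUniformInCoupling (hFI : FeshbachIdentities) : ¬ RobinCoercivityUniformInCoupling := by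
  intro h
  obtain ⟨c, hc, hcγ⟩ := h 1 1 1 1 one_pos one_pos one_pos one_pos
  set γ : ℝ := min 1 (c / 2) with hγdef
  have hγ0 : 0 < γ := lt_min one_pos (by linarith)
  have hγ2 : γ ≤ c / 2 := min_le_right _ _
  have hle := robinConst_le_contact hFI one_pos one_pos one_pos hγ0 one_pos (hcγ γ hγ0)
  nlinarith

/-- Plain `ℓ²`-ellipticity of the Feshbach matrix at fixed parameters, constant, length and threshold:
`c Σ_i ξ_i² ≤ ξᵀ𝔽_N(s)ξ` for `0 < s < s₀`. -/
def L2Body (ω₂ lam β γ T c : ℝ) (N : ℕ) (s₀ : ℝ) : Prop :=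
    let P := Literature.MathematicalPhysics.KineticTheory.HeatConduction.pinnedChain ω₂ lam β γ;
    let X := Literature.MathematicalPhysics.KineticTheory.HeatConduction.PhaseSpace N;
    let μ : MeasureTheory.Measure X := P.gibbsMeasure N T;
    let corr : (X → ℝ) → (X → ℝ) → ℝ → ℝ := fun f g t => (∫ z, f z * (∫ y, g y ∂(P.transitionKernel N T T t.toNNReal z)) ∂μ) - (∫ z, f z ∂μ) * (∫ z, g z ∂μ);
    let lap : ℝ → (X → ℝ) → (X → ℝ) → ℝ := fun s f g => ∫ t in Set.Ioi (0 : ℝ), Real.exp (-(s * t)) * corr f g t;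
    let cov : (X → ℝ) → (X → ℝ) → ℝ := fun f g => (∫ z, f z * g z ∂μ) - (∫ z, f z ∂μ) * (∫ z, g z ∂μ);
    let e : Fin N → X → ℝ := fun x z => z.2 x ^ 2 / 2 + P.U (z.1 x) + ∑ j : Fin N, ((if j.val = x.val + 1 then P.V (z.1 j - z.1 x) / 2 else 0) + (if x.val = j.val + 1 then P.V (z.1 x - z.1 j) / 2 else 0));
    let G : ℝ → Matrix (Fin N) (Fin N) ℝ := fun s => Matrix.of fun x y => lap s (e x) (e y);
    let schur : ℝ → (X → ℝ) → (X → ℝ) → ℝ := fun s f g => lap s f g - ∑ x : Fin N, ∑ y : Fin N, lap s f (e x) * (G s)⁻¹ x y * lap s (e y) g;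
    let F : ℝ → Fin N → Fin N → ℝ := fun s x y => s * cov (e x) (e y) - cov (e x) (P.generator N T T (e y)) - schur s (fun z => P.generator N T T (e x) (z.1, -z.2)) (P.generator N T T (e y));
    ∀ s : ℝ, 0 < s → s < s₀ → ∀ ξ : Fin N → ℝ, c * (∑ i : Fin N, ξ i ^ 2) ≤ ∑ x : Fin N, ∑ y : Fin N, ξ x * F s x y * ξ y

/-- NATURAL STRENGTHENING 3 (refuted below): UNIFORM `ℓ²`-ELLIPTICITY `𝔽_N(s) ≥ c·Id` with `c` independent of `N`
(the Robin form of the crux replaced by `Σ_i ξ_i²`). -/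
def UniformL2Ellipticity : Prop :=
  ∀ ω₂ lam β γ : ℝ, 0 < ω₂ → 0 < lam → 0 < β → 0 < γ → ∀ T : ℝ, 0 < T → ∃ c : ℝ, 0 < c ∧ ∀ N : ℕ, 2 ≤ N →
    ∃ s₀ : ℝ, 0 < s₀ ∧ L2Body ω₂ lam β γ T c N s₀

/-- An `ℓ²`-ellipticity constant at length `N` is at most `2γT²/N` (test profile `ξ ≡ 1`). -/
theorem l2Const_le (hFI : FeshbachIdentities) {ω₂ lam β γ T c : ℝ} {N : ℕ} {s₀ : ℝ} (hω : 0 < ω₂)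
    (hl : 0 < lam) (hβ : 0 < β) (hγ : 0 < γ) (hT : 0 < T) (hN : 2 ≤ N) (hs₀ : 0 < s₀)
    (hbody : L2Body ω₂ lam β γ T c N s₀) : c * N ≤ 2 * (γ * T ^ 2) := by
  have key := one_feshbach_one_le hFI ω₂ lam β γ hω hl hβ hγ T hT N hN
  dsimp only [L2Body] at hbody key
  exact le_of_forall_small hs₀ ⟨_, fun s hs hss => by
    have h1 := hbody s hs hss (fun _ => 1)
    simp only [one_pow, Finset.sum_const, Finset.card_univ, Fintype.card_fin, nsmul_eq_mul, one_mul, mul_one] at h1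
    exact h1.trans (key s hs)⟩

/-- **No uniform `ℓ²`-ellipticity** (modulo `FeshbachIdentities`): against `ξ ≡ 1` the Feshbach matrix is at most
`s·1ᵀCov(e,e)1 + 2γT²` while `Σ ξ_i² = N`, so `c ≤ 2γT²/N → 0`. The crux's Robin form (whose constant profile costs
only the two contact terms) is the right normalisation; plain ellipticity uniform in `N` is false. -/
theorem not_uniformL2Ellipticity (hFI : FeshbachIdentities) : ¬ UniformL2Ellipticity := by
  intro h
  obtain ⟨c, hc, hcN⟩ := h 1 1 1 1 one_pos one_pos one_pos one_pos 1 one_pos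
  obtain ⟨N₀, hN₀⟩ := exists_nat_gt (3 / c)
  set N : ℕ := max 2 N₀ with hNdef
  have hN2 : 2 ≤ N := le_max_left _ _
  have hNc : 3 ≤ c * N := by
    have h2 : (N₀ : ℝ) ≤ N := by exact_mod_cast le_max_right 2 N₀
    have h3 : 3 / c ≤ N := hN₀.le.trans h2
    rwa [div_le_iff₀' hc] at h3
  obtain ⟨s₀, hs₀, hbody⟩ := hcN N hN2
  have hle := l2Const_le hFI one_pos one_pos one_pos one_pos one_pos hN2 hs₀ hbody
  linarith

/-! ### Unconditional versions (the package is landed: `HonestZwanzig.Robin.stub_feshbachIdentities`) -/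

section Unconditional

open Summit.AtomisticToContinuum.FouriersLaw.Theorems.HonestZwanzig.Robin

/-- **Every constant admissible in `RobinCoercivity` is at most the bare contact conductance `γT²`** (unconditional). -/
theorem robinConst_le_contact' {ω₂ lam β γ T c : ℝ} (hω : 0 < ω₂) (hl : 0 < lam) (hβ : 0 < β) (hγ : 0 < γ)
    (hT : 0 < T) (h : RobinCoercivityAt ω₂ lam β γ T c) : c ≤ γ * T ^ 2 :=
  robinConst_le_contact stub_feshbachIdentities hω hl hβ hγ hT h

/-- `RobinCoercivity` can only hold with a constant `c ≤ γT²` (unconditional). -/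
theorem robinCoercivity_const_le' (hRC : RobinCoercivity) {ω₂ lam β γ T : ℝ} (hω : 0 < ω₂) (hl : 0 < lam)
    (hβ : 0 < β) (hγ : 0 < γ) (hT : 0 < T) : ∃ c : ℝ, 0 < c ∧ c ≤ γ * T ^ 2 ∧ RobinCoercivityAt ω₂ lam β γ T c :=
  robinCoercivity_const_le stub_feshbachIdentities hRC hω hl hβ hγ hT

/-- **No `T`-uniform Robin constant** (unconditional). -/
theorem not_robinCoercivityUniformInT' : ¬ RobinCoercivityUniformInT :=
  not_robinCoercivityUniformInT stub_feshbachIdentities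

/-- **No `γ`-uniform Robin constant** (unconditional). -/
theorem not_robinCoercivityUniformInCoupling' : ¬ RobinCoercivityUniformInCoupling :=
  not_robinCoercivityUniformInCoupling stub_feshbachIdentities

/-- **No uniform `ℓ²`-ellipticity of the Feshbach matrix** (unconditional). -/
theorem not_uniformL2Ellipticity' : ¬ UniformL2Ellipticity :=
  not_uniformL2Ellipticity stub_feshbachIdentities

end Unconditional



section FixedN

variable {ω₂ lam β γ : ℝ} {N : ℕ} {T : ℝ}
  {Adm : (PhaseSpace N → ℝ) → Prop}
  {corr : (PhaseSpace N → ℝ) → (PhaseSpace N → ℝ) → ℝ → ℝ}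
  {lap : ℝ → (PhaseSpace N → ℝ) → (PhaseSpace N → ℝ) → ℝ}
  {cov : (PhaseSpace N → ℝ) → (PhaseSpace N → ℝ) → ℝ}
  {e : Fin N → PhaseSpace N → ℝ}
  (hAdm : ∀ f, Adm f ↔ (Continuous f ∧ ∃ A : ℝ, ∀ z,
    |f z| ≤ A * Real.exp ((pinnedChain ω₂ lam β γ).hamiltonian N z / (8 * T))))
  (hcorr : ∀ f g t, corr f g t =
    (∫ z, f z * (∫ y, g y ∂((pinnedChain ω₂ lam β γ).transitionKernel N T T t.toNNReal z))
      ∂(pinnedChain ω₂ lam β γ).gibbsMeasure N T) -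
    (∫ z, f z ∂(pinnedChain ω₂ lam β γ).gibbsMeasure N T) *
      (∫ z, g z ∂(pinnedChain ω₂ lam β γ).gibbsMeasure N T))
  (hlap : ∀ s f g, lap s f g = ∫ t in Set.Ioi (0 : ℝ), Real.exp (-(s * t)) * corr f g t)
  (hcov : ∀ f g, cov f g = (∫ z, f z * g z ∂(pinnedChain ω₂ lam β γ).gibbsMeasure N T) -
    (∫ z, f z ∂(pinnedChain ω₂ lam β γ).gibbsMeasure N T) *
      (∫ z, g z ∂(pinnedChain ω₂ lam β γ).gibbsMeasure N T))
  (he : ∀ x z, e x z = z.2 x ^ 2 / 2 + (pinnedChain ω₂ lam β γ).U (z.1 x) +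
    ∑ j : Fin N, ((if j.val = x.val + 1 then (pinnedChain ω₂ lam β γ).V (z.1 j - z.1 x) / 2 else 0) +
      (if x.val = j.val + 1 then (pinnedChain ω₂ lam β γ).V (z.1 x - z.1 j) / 2 else 0)))
  (hFI : ∀ f g : PhaseSpace N → ℝ, Adm f → Adm g →
    Integrable f ((pinnedChain ω₂ lam β γ).gibbsMeasure N T) ∧
    (∀ t : ℝ, 0 ≤ t → Integrable (fun z => f z *
      (∫ y, g y ∂((pinnedChain ω₂ lam β γ).transitionKernel N T T t.toNNReal z)))
      ((pinnedChain ω₂ lam β γ).gibbsMeasure N T)) ∧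
    IntegrableOn (corr f g) (Set.Ioi 0) ∧
    (∀ t : ℝ, 0 ≤ t → corr f g t = corr (fun z => g (z.1, -z.2)) (fun z => f (z.1, -z.2)) t) ∧
    (∀ s : ℝ, 0 < s → ∀ x : Fin N,
      s * lap s (e x) g - cov (e x) g =
        lap s (fun z => (pinnedChain ω₂ lam β γ).generator N T T (e x) (z.1, -z.2)) g ∧
      s * lap s f (e x) - cov f (e x) = lap s f ((pinnedChain ω₂ lam β γ).generator N T T (e x))))
  (hGSE : ∀ (x : Fin N) (z : PhaseSpace N), (pinnedChain ω₂ lam β γ).generator N T T (e x) z =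
    (∑ b : Fin N, ((if x.val = b.val + 1 then (pinnedChain ω₂ lam β γ).bondCurrent N b z else 0) -
      (if b = x then (pinnedChain ω₂ lam β γ).bondCurrent N b z else 0))) +
    (if x.val = 0 then (pinnedChain ω₂ lam β γ).γ * (T - z.2 x ^ 2) else 0) +
    (if x.val = N - 1 then (pinnedChain ω₂ lam β γ).γ * (T - z.2 x ^ 2) else 0))
  (hPS : ∀ x y : Fin N, cov (e x) ((pinnedChain ω₂ lam β γ).generator N T T (e y)) =
    -(if x = y ∧ (x.val = 0 ∨ x.val = N - 1) then (pinnedChain ω₂ lam β γ).γ * T ^ 2 else 0))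
  (hω : 0 < ω₂) (hl : 0 ≤ lam) (hβ : 0 ≤ β) (hγ : 0 ≤ γ) (hT : 0 < T)

include hcorr hlap in
/-- `schur_s(f, c·g) = c·schur_s(f, g)` (any matrix `G`; no integrability needed). -/
theorem schur_const_mul_right' (s : ℝ) (G : Matrix (Fin N) (Fin N) ℝ)
    (schur : (PhaseSpace N → ℝ) → (PhaseSpace N → ℝ) → ℝ)
    (hschur : ∀ f g, schur f g = lap s f g - ∑ u, ∑ v, lap s f (e u) * G⁻¹ u v * lap s (e v) g)
    (c : ℝ) (f g : PhaseSpace N → ℝ) : schur f (fun z => c * g z) = c * schur f g := by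
  rw [hschur, hschur]
  simp only [lap_const_mul_right hcorr hlap, mul_sub, Finset.mul_sum]
  congr 1
  exact Finset.sum_congr rfl fun u _ => Finset.sum_congr rfl fun v _ => by ring

include hcorr hlap in
/-- `schur_s(c·f, g) = c·schur_s(f, g)`. -/
theorem schur_const_mul_left' (s : ℝ) (G : Matrix (Fin N) (Fin N) ℝ)
    (schur : (PhaseSpace N → ℝ) → (PhaseSpace N → ℝ) → ℝ)
    (hschur : ∀ f g, schur f g = lap s f g - ∑ u, ∑ v, lap s f (e u) * G⁻¹ u v * lap s (e v) g)
    (c : ℝ) (f g : PhaseSpace N → ℝ) : schur (fun z => c * f z) g = c * schur f g := by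
  rw [hschur, hschur]
  simp only [lap_const_mul_left hcorr hlap, mul_sub, Finset.mul_sum]
  congr 1
  exact Finset.sum_congr rfl fun u _ => Finset.sum_congr rfl fun v _ => by ring

include hAdm hcorr hlap he hFI hω hl hβ hT in
/-- Additivity of the Schur pairing in each slot (admissible observables, `s ≥ 0`). -/
theorem schur_add_add {s : ℝ} (hs : 0 ≤ s) (G : Matrix (Fin N) (Fin N) ℝ)
    (schur : (PhaseSpace N → ℝ) → (PhaseSpace N → ℝ) → ℝ)
    (hschur : ∀ f g, schur f g = lap s f g - ∑ u, ∑ v, lap s f (e u) * G⁻¹ u v * lap s (e v) g)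
    {f₁ f₂ g₁ g₂ : PhaseSpace N → ℝ} (hf₁ : Adm f₁) (hf₂ : Adm f₂) (hg₁ : Adm g₁) (hg₂ : Adm g₂) :
    schur (fun z => f₁ z + f₂ z) (fun z => g₁ z + g₂ z) =
      schur f₁ g₁ + schur f₁ g₂ + schur f₂ g₁ + schur f₂ g₂ := by
  -- two-element families through `sum_sum_schur_eq_schur_sum`
  have h := sum_sum_schur_eq_schur_sum hAdm hcorr hlap he hFI hω hl hβ hT hs G schur hschur Finset.univ Finset.univ
    (fun i : Fin 2 => if i = 0 then f₁ else f₂) (fun k : Fin 2 => if k = 0 then g₁ else g₂)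
    (fun i _ => by fin_cases i <;> simpa) (fun k _ => by fin_cases k <;> simpa)
  simp only [Fin.sum_univ_two, Fin.isValue, show (1 : Fin 2) ≠ 0 from by decide, if_true, if_false] at h
  rw [← h]
  ring

include hAdm hcorr hlap he hFI hω hl hβ hT in
/-- **Time reversal for the Schur pairing of an odd and an even observable**: `schur_s(j, w) = −schur_s(w, j)` when
`j∘Θ = −j`, `w∘Θ = w` and `G = G(s)` (symmetric). -/
theorem schur_odd_even {s : ℝ} (G : Matrix (Fin N) (Fin N) ℝ) (hG : ∀ x y, G x y = lap s (e x) (e y))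
    (schur : (PhaseSpace N → ℝ) → (PhaseSpace N → ℝ) → ℝ)
    (hschur : ∀ f g, schur f g = lap s f g - ∑ u, ∑ v, lap s f (e u) * G⁻¹ u v * lap s (e v) g)
    {j w : PhaseSpace N → ℝ} (hj : Adm j) (hw : Adm w) (hjodd : ∀ z, j (z.1, -z.2) = -j z)
    (hweven : ∀ z, w (z.1, -z.2) = w z) : schur j w = -schur w j := by
  classical
  have hex : ∀ x, Adm (e x) := fun x => adm_e Adm hAdm e he hω hl hβ hT x
  have hjfun : (fun z : PhaseSpace N => j (z.1, -z.2)) = fun z => (-1 : ℝ) * j z := funext fun z => by rw [hjodd]; ring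
  have hwfun : (fun z : PhaseSpace N => w (z.1, -z.2)) = w := funext hweven
  have hefun : ∀ u, (fun z : PhaseSpace N => e u (z.1, -z.2)) = e u := fun u => funext fun z => e_neg_momentum _ e he u z
  have h1 : lap s j w = -lap s w j := by
    rw [lap_rev hlap hFI hj hw, hwfun, hjfun, lap_const_mul_right hcorr hlap]; ring
  have h2 : ∀ u, lap s j (e u) = -lap s (e u) j := fun u => by
    rw [lap_rev hlap hFI hj (hex u), hefun, hjfun, lap_const_mul_right hcorr hlap]; ring
  have h3 : ∀ v, lap s (e v) w = lap s w (e v) := fun v => by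
    rw [lap_rev hlap hFI (hex v) hw, hwfun, hefun]
  have hGsym : ∀ x y, G x y = G y x := fun x y => by rw [hG, hG, pkg_G_symm hAdm hlap he hFI hω hl hβ hT s]
  have hGT : Gᵀ = G := transpose_eq_of_symm G hGsym
  have hGinv : ∀ u v, G⁻¹ u v = G⁻¹ v u := fun u v => by
    have := congrFun (congrFun (Matrix.transpose_nonsing_inv G) v) u
    rw [hGT, Matrix.transpose_apply] at this
    exact this
  rw [hschur, hschur, h1]
  simp only [h2, h3]
  rw [Finset.sum_comm]
  have : ∑ y, ∑ x, -lap s (e x) j * G⁻¹ x y * lap s w (e y) = -∑ u, ∑ v, lap s w (e u) * G⁻¹ u v * lap s (e v) j := by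
    rw [← Finset.sum_neg_distrib]
    refine Finset.sum_congr rfl fun u _ => ?_
    rw [← Finset.sum_neg_distrib]
    refine Finset.sum_congr rfl fun v _ => ?_
    rw [hGinv v u]; ring
  rw [this]; ring

include hGSE in
/-- The weighted generator image, pointwise: `Σ_x ξ_x (L e_x)(z) = j_ξ(z) + w_ξ(z)`. -/
theorem sum_mul_generator_splitSite (ξ : Fin N → ℝ) (z : PhaseSpace N) :
    ∑ x, ξ x * (pinnedChain ω₂ lam β γ).generator N T T (e x) z =
      (∑ x, ξ x * ∑ b : Fin N, ((if x.val = b.val + 1 then (pinnedChain ω₂ lam β γ).bondCurrent N b z else 0) -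
        (if b = x then (pinnedChain ω₂ lam β γ).bondCurrent N b z else 0))) +
      ∑ x, ξ x * ((if x.val = 0 then (pinnedChain ω₂ lam β γ).γ * (T - z.2 x ^ 2) else 0) +
        (if x.val = N - 1 then (pinnedChain ω₂ lam β γ).γ * (T - z.2 x ^ 2) else 0)) := by
  rw [← Finset.sum_add_distrib]
  refine Finset.sum_congr rfl fun x _ => ?_
  rw [hGSE]; ring

include hGSE in
/-- The weighted REVERSED generator image, pointwise: `Σ_x ξ_x (L e_x)(q,−p) = −j_ξ(z) + w_ξ(z)`. -/
theorem sum_mul_generator_splitSite_rev (ξ : Fin N → ℝ) (z : PhaseSpace N) :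
    ∑ x, ξ x * (pinnedChain ω₂ lam β γ).generator N T T (e x) (z.1, -z.2) =
      -(∑ x, ξ x * ∑ b : Fin N, ((if x.val = b.val + 1 then (pinnedChain ω₂ lam β γ).bondCurrent N b z else 0) -
        (if b = x then (pinnedChain ω₂ lam β γ).bondCurrent N b z else 0))) +
      ∑ x, ξ x * ((if x.val = 0 then (pinnedChain ω₂ lam β γ).γ * (T - z.2 x ^ 2) else 0) +
        (if x.val = N - 1 then (pinnedChain ω₂ lam β γ).γ * (T - z.2 x ^ 2) else 0)) := by
  rw [← Finset.sum_neg_distrib, ← Finset.sum_add_distrib]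
  refine Finset.sum_congr rfl fun x _ => ?_
  rw [hGSE]
  simp only [OscillatorChain.bondCurrent_neg_momentum, Pi.neg_apply, neg_sq]
  have : ∀ b : Fin N, ((if x.val = b.val + 1 then -(pinnedChain ω₂ lam β γ).bondCurrent N b z else 0) -
      (if b = x then -(pinnedChain ω₂ lam β γ).bondCurrent N b z else 0)) =
      -((if x.val = b.val + 1 then (pinnedChain ω₂ lam β γ).bondCurrent N b z else 0) -
        (if b = x then (pinnedChain ω₂ lam β γ).bondCurrent N b z else 0)) := fun b => by
    split_ifs <;> ring
  simp only [this, Finset.sum_neg_distrib]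
  ring

include hAdm hcorr hlap hFI he hGSE hPS hω hl hβ hT in
/-- **The even/odd decomposition of the Feshbach quadratic form.** For `N ≥ 2`, `s > 0`, the fixed-`N` package and
`G = G(s)`: with the odd observable `j_ξ = Σ_x ξ_x (j_{x−1} − j_x)` and the even one
`w_ξ = γ Σ_x ξ_x ([x=0] + [x=N−1])(T − p_x²)`,
`ξᵀ𝔽ξ = s·ξᵀCov(e,e)ξ + γT²(ξ_0² + ξ_{N−1}²) − schur_s(w_ξ,w_ξ) − 2·schur_s(w_ξ,j_ξ) + schur_s(j_ξ,j_ξ)`. -/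
theorem feshbach_quadratic_decomposition (hN : 2 ≤ N) {s : ℝ} (hs : 0 < s)
    (G : Matrix (Fin N) (Fin N) ℝ) (hG : ∀ x y, G x y = lap s (e x) (e y))
    (schur : (PhaseSpace N → ℝ) → (PhaseSpace N → ℝ) → ℝ)
    (hschur : ∀ f g, schur f g = lap s f g - ∑ u, ∑ v, lap s f (e u) * G⁻¹ u v * lap s (e v) g)
    (F : Fin N → Fin N → ℝ)
    (hF : ∀ x y, F x y = s * cov (e x) (e y) - cov (e x) ((pinnedChain ω₂ lam β γ).generator N T T (e y)) -
      schur (fun z => (pinnedChain ω₂ lam β γ).generator N T T (e x) (z.1, -z.2))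
        ((pinnedChain ω₂ lam β γ).generator N T T (e y)))
    (ξ : Fin N → ℝ) (jξ wξ : PhaseSpace N → ℝ)
    (hj : ∀ z, jξ z = ∑ x, ξ x * ∑ b : Fin N,
      ((if x.val = b.val + 1 then (pinnedChain ω₂ lam β γ).bondCurrent N b z else 0) -
        (if b = x then (pinnedChain ω₂ lam β γ).bondCurrent N b z else 0)))
    (hw : ∀ z, wξ z = ∑ x, ξ x * ((if x.val = 0 then (pinnedChain ω₂ lam β γ).γ * (T - z.2 x ^ 2) else 0) +
      (if x.val = N - 1 then (pinnedChain ω₂ lam β γ).γ * (T - z.2 x ^ 2) else 0))) :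
    ∑ x, ∑ y, ξ x * F x y * ξ y =
      s * (∑ x, ∑ y, ξ x * cov (e x) (e y) * ξ y) +
        (pinnedChain ω₂ lam β γ).γ * T ^ 2 *
          (∑ i : Fin N, ((if i.val = 0 then ξ i ^ 2 else 0) + (if i.val = N - 1 then ξ i ^ 2 else 0))) -
        schur wξ wξ - 2 * schur wξ jξ + schur jξ jξ := by
  have hLf : ∀ x, Adm ((pinnedChain ω₂ lam β γ).generator N T T (e x)) :=
    fun x => adm_generator_e hAdm hGSE hω hl hβ hT x
  have hLr : ∀ x, Adm (fun z => (pinnedChain ω₂ lam β γ).generator N T T (e x) (z.1, -z.2)) :=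
    fun x => adm_rev Adm hAdm (hLf x)
  -- admissibility and parity of `j_ξ`, `w_ξ`
  have hjadm : Adm jξ := by
    refine adm_of_eq Adm hj (adm_sum Adm hAdm Finset.univ _ (adm_const Adm hAdm hω hl hβ hT 0) fun x _ => ?_)
    refine adm_const_mul Adm hAdm _ (adm_sum Adm hAdm Finset.univ _ (adm_const Adm hAdm hω hl hβ hT 0) fun b _ => ?_)
    exact adm_sub Adm hAdm
      (adm_ite Adm _ (adm_bondCurrent Adm hAdm hω hl hβ hT b) (adm_const Adm hAdm hω hl hβ hT 0))
      (adm_ite Adm _ (adm_bondCurrent Adm hAdm hω hl hβ hT b) (adm_const Adm hAdm hω hl hβ hT 0))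
  have hwadm : Adm wξ := by
    refine adm_of_eq Adm hw (adm_sum Adm hAdm Finset.univ _ (adm_const Adm hAdm hω hl hβ hT 0) fun x _ => ?_)
    refine adm_const_mul Adm hAdm _ (adm_add Adm hAdm ?_ ?_)
    · exact adm_ite Adm _ (adm_const_mul Adm hAdm _ (adm_sub Adm hAdm (adm_const Adm hAdm hω hl hβ hT T)
        (adm_psq Adm hAdm hω hl hβ hT x))) (adm_const Adm hAdm hω hl hβ hT 0)
    · exact adm_ite Adm _ (adm_const_mul Adm hAdm _ (adm_sub Adm hAdm (adm_const Adm hAdm hω hl hβ hT T)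
        (adm_psq Adm hAdm hω hl hβ hT x))) (adm_const Adm hAdm hω hl hβ hT 0)
  have hjodd : ∀ z, jξ (z.1, -z.2) = -jξ z := fun z => by
    rw [hj, hj, ← Finset.sum_neg_distrib]
    refine Finset.sum_congr rfl fun x _ => ?_
    rw [← mul_neg, ← Finset.sum_neg_distrib]
    congr 1
    refine Finset.sum_congr rfl fun b _ => ?_
    simp only [OscillatorChain.bondCurrent_neg_momentum]
    split_ifs <;> ring
  have hweven : ∀ z, wξ (z.1, -z.2) = wξ z := fun z => by
    rw [hw, hw]
    simp only [Pi.neg_apply, neg_sq]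
  -- the weighted generator images
  have hgsum : (fun z => ∑ y, ξ y * (pinnedChain ω₂ lam β γ).generator N T T (e y) z) = fun z => jξ z + wξ z := by
    funext z; rw [sum_mul_generator_splitSite hGSE ξ z, hj, hw]
  have hfsum : (fun z => ∑ x, ξ x * (pinnedChain ω₂ lam β γ).generator N T T (e x) (z.1, -z.2)) =
      fun z => (-1 : ℝ) * jξ z + wξ z := by
    funext z; rw [sum_mul_generator_splitSite_rev hGSE ξ z, hj, hw]; ring
  -- (1) the Schur block
  have hS : ∑ x, ∑ y, ξ x * schur (fun z => (pinnedChain ω₂ lam β γ).generator N T T (e x) (z.1, -z.2))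
      ((pinnedChain ω₂ lam β γ).generator N T T (e y)) * ξ y =
      -schur jξ jξ - schur jξ wξ + schur wξ jξ + schur wξ wξ := by
    have h1 : ∀ x y, ξ x * schur (fun z => (pinnedChain ω₂ lam β γ).generator N T T (e x) (z.1, -z.2))
        ((pinnedChain ω₂ lam β γ).generator N T T (e y)) * ξ y =
        schur (fun z => ξ x * (pinnedChain ω₂ lam β γ).generator N T T (e x) (z.1, -z.2))
          (fun z => ξ y * (pinnedChain ω₂ lam β γ).generator N T T (e y) z) := fun x y => by
      rw [schur_const_mul_left' hcorr hlap s G schur hschur, schur_const_mul_right' hcorr hlap s G schur hschur]; ring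
    simp only [h1]
    rw [sum_sum_schur_eq_schur_sum hAdm hcorr hlap he hFI hω hl hβ hT hs.le G schur hschur Finset.univ Finset.univ
      (fun x z => ξ x * (pinnedChain ω₂ lam β γ).generator N T T (e x) (z.1, -z.2))
      (fun y z => ξ y * (pinnedChain ω₂ lam β γ).generator N T T (e y) z)
      (fun x _ => adm_const_mul Adm hAdm _ (hLr x)) (fun y _ => adm_const_mul Adm hAdm _ (hLf y)), hfsum, hgsum,
      schur_add_add hAdm hcorr hlap he hFI hω hl hβ hT hs.le G schur hschur (adm_const_mul Adm hAdm _ hjadm) hwadm hjadm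
        hwadm, schur_const_mul_left' hcorr hlap s G schur hschur, schur_const_mul_left' hcorr hlap s G schur hschur]
    ring
  have hodd := schur_odd_even hAdm hcorr hlap he hFI hω hl hβ hT G hG schur hschur hjadm hwadm hjodd hweven
  -- (2) the static block
  have hC : ∑ x, ∑ y, ξ x * cov (e x) ((pinnedChain ω₂ lam β γ).generator N T T (e y)) * ξ y =
      -((pinnedChain ω₂ lam β γ).γ * T ^ 2) *
        ∑ i : Fin N, ((if i.val = 0 then ξ i ^ 2 else 0) + (if i.val = N - 1 then ξ i ^ 2 else 0)) := by
    rw [← sum_sum_neg_ite_diag_boundary hN ((pinnedChain ω₂ lam β γ).γ * T ^ 2) ξ]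
    exact Finset.sum_congr rfl fun x _ => Finset.sum_congr rfl fun y _ => by rw [hPS]
  -- assemble
  have hsplit : ∑ x, ∑ y, ξ x * F x y * ξ y = s * (∑ x, ∑ y, ξ x * cov (e x) (e y) * ξ y) -
      ∑ x, ∑ y, ξ x * cov (e x) ((pinnedChain ω₂ lam β γ).generator N T T (e y)) * ξ y -
      ∑ x, ∑ y, ξ x * schur (fun z => (pinnedChain ω₂ lam β γ).generator N T T (e x) (z.1, -z.2))
        ((pinnedChain ω₂ lam β γ).generator N T T (e y)) * ξ y := by
    simp only [hF, Finset.mul_sum, ← Finset.sum_sub_distrib]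
    exact Finset.sum_congr rfl fun x _ => Finset.sum_congr rfl fun y _ => by ring
  rw [hsplit, hC, hS, hodd]
  ring

end FixedN


/-! ### Targets (lead's stuck stubs)

None at cycle 1 (`stuck_stubs = []`). Line LinAlg: stubs 1–4 landed true (p99025, p96750, p96720, p97096); stub 5
`stub_fluxBound` ≡ crux (polar duality both ways) — the structural identity the provers may want instead is
`feshbach_quadratic_decomposition` (landed as `…Negative.feshbach_quadratic_decomposition`, p105753), with `schur_self_nonneg`
(p103180) for the two diagonal memory terms and `schur_odd_even` for the cross term.

### Near-misses

None formal. NOT refuted and believed true (numerically monotone in `s`): the crux with `s₀` uniform in `N`, or for all `s > 0`.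
-/

end Summit.AtomisticToContinuum.FouriersLaw.Cruxes.RobinCoercivity.Disproof

end
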